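import Literature.AlgebraicGeometry.Resolution.DecompletionBridgeCoordinate
import Literature.AlgebraicGeometry.Resolution.DecompletionPolydiscLambda
import HarnessLib

/-!
# Temkin's decompletion lemma, algebraic proof — XII–XVI. The common smooth roof; `Temkin2013_Lemma332_nft` PROVED

Topic: `Literature/AlgebraicGeometry/Resolution`. M. Temkin, *Inseparable local uniformization*,
J. Algebra 373 (2013) 65–119 = arXiv:0804.1554v3, Lemma 3.3.2 (tree: the corrected rendering
`Temkin2013_Lemma332_nft`, `InseparableLocalUniformizationDecompletion.lean`; held arXiv
version p. 28). This file completes the algebraic proof of the lemma carried out in the series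
`DecompletionChartCore`, `DecompletionSetup`, `DecompletionControl`, `DecompletionZoom`,
`DecompletionZoomRings`, `DecompletionHensel`, `DecompletionHenselPoint`,
`DecompletionPolydiscData/Algebra`, `DecompletionPolydisc`, `DecompletionPolydiscLambda`,
`DecompletionBridgeCoordinate` (files I–XI: the étale chart of the generic fibre at the simple
smooth point, the zoomed model `A′_j = Nr_K(k°[f, τ/πʲ])` = Temkin's `Nr(Spec A[f/π])`, the
Hensel chart `D₀` étale over the localization `A″_j` of `A′_j`, the `m°`-polydisc chart `E₀`
étale over `m°[X₁,…,X_n]`, the `K`-side bridge `λ₀ : A″_j → E₀`, `Λ₀ : D₀ → E₁`, and the Newton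
coordinate `W_D ∈ D₀`), by identifying localizations of the two charts and reading off the
common smooth roof of Definition 2.8.1:

* **XII. The `m°`-structure of the Hensel chart.** `intN` (elements of `m` integral over `k°`),
  `θN : N →+* D₀` (bundling `θ₀`), `m° = N[1/f]` as an `IsLocalization.Away` structure,
  `D₁ = D₀[1/θN f]`, its point `σ₁`, `μO : m° → D₁` with `σ₁ ∘ μO = id`; the ambient rings
  `Ω_S = S ⊗_{A″_j} K` of flat `A″_j`-algebras (`ι_S` injective, transitions, `Ξ_S`), and
  `ι₁ ∘ μO = Ξ₁` — PROVED.
* **XIII. The bridge map `μ : E₀ → D₂`.** `μB : m°[X] → D₁` (`Xᵢ ↦ u′_{D,i} = Tᵢ/π^{j_z}`), the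
  `D`-side evaluation chain `ι₁(Ψ_O(π^{j_z}u′_D, w₀′ + c₀′π^r W_D)) = ι_K(Ψ_k(T, w′))`, whence
  `F̃(u′_D, W_D) = 0`; `D₂ = D₁[1/g_E(u′_D, W_D)]` (smooth over `A″_j`), its point `σ₂`,
  `μ = EtalePair.lift : E₀ →ₐ[m°[X]] D₂` with `σ₂ ∘ μ = σ_E`; the mirror lemma
  `ι₂(μ(zE z)) = ι_K(z)` — PROVED.
* **XIV. Identities.** (P1) `μ ∘ λ₀ = A″_j → D₂` (generators of `A₀`, then `Frac(A₀) = K` and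
  flatness of `D₂`); (P2) `μ(Z_E) = Z`; hence `μ₁ : E₁ → D₂` and (α) `μ₁ ∘ Λ₀ = D₀ → D₂` —
  PROVED.
* **XV. The inverse bridge.** Ambients `Ω_T = T ⊗_{m°} m`; (P3) `Λ₀ ∘ θN = N → E₁`, hence
  `Λ₁ : D₁ → E₁` with `Λ₁ ∘ μB = m°[X] → E₁`; (P4) `Λ₁(W_D) = W`; hence `Λ₂ : D₂ → E₁`, (β)
  `Λ₂ ∘ μ = E₀ → E₁`, and the ring isomorphism `roofEquiv : E₁ ≃ D₂` — PROVED.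
* **XVI. The roof.** `D₂` is smooth over `A′_j` (standard-étale type over two localizations of
  `A′_j`) and over `m°` (transport along `roofEquiv`, an `m°`-algebra isomorphism, from the
  localization `E₁` of the étale `m°[X]`-algebra `E₀`); with its point `r₂` it is the common
  smooth roof: `areSmoothEquivalent_centre`; admissible parameters exist (`ε₀`, `eHyps₀`);
  **`Temkin2013_Lemma332_nft_holds : Temkin2013_Lemma332_nft`** — THE DISCHARGE of the named
  fact — PROVED. (The printed proof, p. 28 of the held version / pp. 45–46 of v3, is
  Berkovich-analytic: [Ber2, 3.3.6/3.4.1], Weierstrass domains, Thm. 2.8.2 (ii). The algebraic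
  proof replaces the analytic local structure at the smooth point by an explicit standard étale
  chart at finite level, Hensel's lemma in the completion by the explicit étale Hensel chart, and
  the unit `m̂°`-polydisc by the explicit étale `m°[X]`-algebra `E₀`; the equal-characteristic
  hypothesis of the fact is not used.)

All declarations of steps XII–XVI live in the sub-namespace `DecompChart.Roof`; they are
[folklore] glue (explicit rings and ring homomorphisms of the construction and identities
between them); no new named facts (net debt −1: `Temkin2013_Lemma332_nft` discharged).

## Sources

* M. Temkin, arXiv:0804.1554v3, Lemma 3.3.2 and its proof (pp. 45–46); Definition 2.8.1 (p. 29);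
  held arXiv version (41 pp.): Lemma 3.3.2 and proof, p. 28; Definition 2.7.1, p. 18.
-/

noncomputable section

open Polynomial TensorProduct

namespace Literature.AlgebraicGeometry.Resolution

universe u

variable {k K m : Type u} [Field k] [Field K] [Algebra k K] [Field m] [Algebra k m]

namespace DecompChart

namespace Roof

variable {V : ValuationSubring k} {O : ValuationSubring m} {A : Subring K}
  {φ : Algebra.adjoin k (A : Set K) →ₐ[k] m} (C : DecompChart V O A φ)

/-! ## XII. The `m°`-structure of the Hensel chart -/

section StepXII

/-! ### The ring `N` of `k°`-integral elements of `m` and `θN : N → D₀` -/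

/-- The ring `N ⊆ m` of elements integral over (the image of) `k°`. [folklore] -/
abbrev intN (V : ValuationSubring k) : Subalgebra (baseRing m V) m := integralClosure (baseRing m V) m

omit [Algebra k K] in
/-- Membership in `N`. [folklore] -/
theorem mem_intN_iff {ν : m} : ν ∈ intN (m := m) V ↔ IsIntegral (baseRing m V) ν :=
  mem_integralClosure_iff _ _

section Theta

variable (e : ℕ) {j : ℕ} (hj : C.jH ≤ j) (hje : C.bp + e + 2 * C.Na ≤ j)

/-- **`θN : N →+* D₀`** — the honest preimages of `Ξ(ν)` for integral `ν`, as a ring homomorphism.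
[folklore] -/
def θN : intN (m := m) V →+* C.D₀ e hj hje where
  toFun ν := C.θ₀ e hj hje (mem_intN_iff.mp ν.2)
  map_one' := C.ιD_injective e hj hje (by rw [C.ιD_θ₀, map_one, OneMemClass.coe_one, map_one])
  map_mul' a b := by
    rw [← C.θ₀_mul e hj hje (mem_intN_iff.mp a.2) (mem_intN_iff.mp b.2)]
  map_zero' := C.ιD_injective e hj hje (by rw [C.ιD_θ₀, map_zero, ZeroMemClass.coe_zero, map_zero])
  map_add' a b := by
    rw [← C.θ₀_add e hj hje (mem_intN_iff.mp a.2) (mem_intN_iff.mp b.2)]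

/-- `θN ν = θ₀ ν`. [folklore] -/
theorem θN_apply (ν : intN (m := m) V) : θN C e hj hje ν = C.θ₀ e hj hje (mem_intN_iff.mp ν.2) := rfl

/-- `ι_D(θN ν) = Ξ(ν)`. [folklore] -/
@[simp] theorem ιD_θN (ν : intN (m := m) V) : C.ιD e hj hje (θN C e hj hje ν) = C.Ξ e hj hje ν :=
  C.ιD_θ₀ e hj hje (mem_intN_iff.mp ν.2)

/-- `σ_D(θN ν) = ν`. [folklore] -/
@[simp] theorem σDr_θN (ν : intN (m := m) V) : (C.σDr e hj hje (θN C e hj hje ν) : m) = ν :=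
  C.σDr_θ₀ e hj hje (mem_intN_iff.mp ν.2)

/-- `θN` on `k°`: the structure map. [folklore] -/
theorem θN_algebraMap (v : V) :
    θN C e hj hje ⟨algebraMap k m v, mem_intN_iff.mpr (isIntegral_algebraMap_of_mem V v.2)⟩ =
      algebraMap (C.A'' hj) (C.D₀ e hj hje) (C.baseToA'' hj v) :=
  C.ιD_injective e hj hje (by rw [ιD_θN]; exact C.Ξ_algebraMap_V e hj hje v)

/-- **The comparison `π^d · θN(ν) = Θ(ζ)`** for `ν` with `Θ(y₀) = π^d ν`. [folklore] -/
theorem pow_mul_θN_eq_aeval (ν : intN (m := m) V) (Θ : V[X]) (d : ℕ)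
    (hΘ : Polynomial.aeval C.y₀ (Θ.map (algebraMap V k)) = algebraMap k m C.π ^ d * ν) :
    algebraMap (C.A'' hj) (C.D₀ e hj hje) (C.πS hj ^ d) * θN C e hj hje ν =
      Polynomial.aeval (C.ζ e hj hje)
        (Θ.map ((algebraMap (C.A'' hj) (C.D₀ e hj hje)).comp (C.baseToA'' hj))) := by
  apply C.ιD_injective e hj hje
  rw [map_mul, ιD_θN, ← C.Ξ_aeval_y₀, hΘ, map_mul, ← C.ιK_coe, SubmonoidClass.coe_pow, map_pow,
    map_pow, show ((C.πS hj : C.A'' hj) : K) = algebraMap k K C.π from rfl, ← C.Ξ_algebraMap e hj hje]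

end Theta

/-! ### `m° = N[1/f]` as a localization -/

section OLoc

/-- `N → m°` (integral elements lie in the valuation ring). [folklore] -/
def NtoO : intN (m := m) V →+* O where
  toFun ν := ⟨ν, C.mem_O_of_isIntegral (mem_intN_iff.mp ν.2)⟩
  map_one' := rfl
  map_mul' _ _ := rfl
  map_zero' := rfl
  map_add' _ _ := rfl

/-- `(NtoO ν : m) = ν`. [folklore] -/
@[simp] theorem coe_NtoO (ν : intN (m := m) V) : ((NtoO C ν : O) : m) = ν := rfl

/-- `m°` as an `N`-algebra. [folklore] -/
abbrev algNO : Algebra (intN (m := m) V) O := (NtoO C).toAlgebra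

/-- The denominator `f ∈ N`. [folklore] -/
def fN : intN (m := m) V := ⟨C.fO, mem_intN_iff.mpr C.fO_isIntegral⟩

/-- `(fN : m) = f`. [folklore] -/
@[simp] theorem coe_fN : ((fN C : intN (m := m) V) : m) = C.fO := rfl

/-- **`m° = N[1/f]`**: `m°` is the localization of `N` away from `f`. [folklore] -/
theorem isLocalization_O : letI := algNO C
    IsLocalization.Away (fN C) O := by
  letI := algNO C
  refine ⟨?_, ?_, ?_⟩
  · rintro ⟨_, n, rfl⟩
    rw [map_pow]
    refine IsUnit.pow n ?_
    refine isUnit_iff_exists_inv.mpr ⟨⟨C.fO⁻¹, C.fO_inv_mem⟩, Subtype.ext ?_⟩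
    change C.fO * C.fO⁻¹ = 1
    exact mul_inv_cancel₀ C.fO_ne_zero
  · intro x
    obtain ⟨a, ha, n, hx⟩ := (C.mem_O_iff x).mp x.2
    refine ⟨⟨⟨a, mem_intN_iff.mpr ha⟩, ⟨fN C ^ n, n, rfl⟩⟩, Subtype.ext ?_⟩
    change (x : m) * (C.fO ^ n) = a
    rw [hx, div_mul_cancel₀ _ (pow_ne_zero n C.fO_ne_zero)]
  · intro a b hab
    refine ⟨1, ?_⟩
    have : (a : m) = b := by
      have := congrArg (fun x : O => (x : m)) hab
      exact this
    rw [Subtype.ext this]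

end OLoc

/-! ### The localized Hensel chart `D₁ = D₀[1/θN(f)]` -/

section D1

variable (e : ℕ) {j : ℕ} (hj : C.jH ≤ j) (hje : C.bp + e + 2 * C.Na ≤ j)

/-- The element `θN(f) ∈ D₀` to be inverted. [folklore] -/
def θf : C.D₀ e hj hje := θN C e hj hje (fN C)

/-- `σ_D(θN f) = f`, a unit of `m°`. [folklore] -/
theorem isUnit_σDr_θf : IsUnit (C.σDr e hj hje (θf C e hj hje)) := by
  refine isUnit_iff_exists_inv.mpr ⟨⟨C.fO⁻¹, C.fO_inv_mem⟩, Subtype.ext ?_⟩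
  change (C.σDr e hj hje (θf C e hj hje) : m) * C.fO⁻¹ = 1
  rw [θf, σDr_θN, coe_fN, mul_inv_cancel₀ C.fO_ne_zero]

/-- **`D₁ = D₀[1/θN(f)]`.** [folklore] -/
abbrev D₁ : Type u := Localization.Away (θf C e hj hje)

/-- `D₁` is smooth over `D₀`. [folklore] -/
instance smooth_D₁_D₀ : Algebra.Smooth (C.D₀ e hj hje) (D₁ C e hj hje) :=
  Algebra.Smooth.of_isLocalization_Away (θf C e hj hje)

/-- **`D₁` is smooth over `A″_j`.** [folklore] -/
instance smooth_D₁ : Algebra.Smooth (C.A'' hj) (D₁ C e hj hje) :=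
  Algebra.Smooth.comp (C.A'' hj) (C.D₀ e hj hje) (D₁ C e hj hje)

/-- The point `σ₁ : D₁ → m°` extending `σ_D`. [folklore] -/
def σ₁ : D₁ C e hj hje →+* O :=
  IsLocalization.Away.lift (θf C e hj hje) (g := C.σDr e hj hje) (isUnit_σDr_θf C e hj hje)

/-- `σ₁` extends `σ_D`. [folklore] -/
@[simp] theorem σ₁_algebraMap (x : C.D₀ e hj hje) :
    σ₁ C e hj hje (algebraMap (C.D₀ e hj hje) (D₁ C e hj hje) x) = C.σDr e hj hje x :=
  IsLocalization.Away.lift_eq _ _ x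

/-- `σ₁` on `A″_j`: the value at the point. [folklore] -/
theorem σ₁_algebraMap_A'' (a : C.A'' hj) :
    (σ₁ C e hj hje (algebraMap (C.A'' hj) (D₁ C e hj hje) a) : m) = ev φ (a : K) := by
  rw [IsScalarTower.algebraMap_apply (C.A'' hj) (C.D₀ e hj hje) (D₁ C e hj hje), σ₁_algebraMap,
    C.σDr_algebraMap]

/-- `θN(f)` is a unit of `D₁`. [folklore] -/
theorem isUnit_θf : IsUnit (algebraMap (C.D₀ e hj hje) (D₁ C e hj hje) (θf C e hj hje)) :=
  IsLocalization.Away.algebraMap_isUnit _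

/-- **`μO : m° → D₁`** — the `m°`-algebra structure of the Hensel chart (`m° = N[1/f]`,
`N → D₀ → D₁`, `θN(f)` inverted). [folklore] -/
def μO : O →+* D₁ C e hj hje :=
  letI := algNO C
  haveI := isLocalization_O C
  IsLocalization.Away.lift (fN C) (g := (algebraMap (C.D₀ e hj hje) (D₁ C e hj hje)).comp (θN C e hj hje))
    (by rw [RingHom.comp_apply]; exact isUnit_θf C e hj hje)

/-- `μO` on integral elements: `θN`. [folklore] -/
theorem μO_NtoO (ν : intN (m := m) V) :
    μO C e hj hje (NtoO C ν) = algebraMap (C.D₀ e hj hje) (D₁ C e hj hje) (θN C e hj hje ν) := by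
  letI := algNO C
  haveI := isLocalization_O C
  exact IsLocalization.Away.lift_eq (fN C) _ ν

/-- `μO` on an integral element given by membership. [folklore] -/
theorem μO_of_isIntegral {ν : m} (hν : IsIntegral (baseRing m V) ν) :
    μO C e hj hje ⟨ν, C.mem_O_of_isIntegral hν⟩ =
      algebraMap (C.D₀ e hj hje) (D₁ C e hj hje) (C.θ₀ e hj hje hν) :=
  μO_NtoO C e hj hje ⟨ν, mem_intN_iff.mpr hν⟩

/-- Two ring homomorphisms out of `m°` agreeing on `N` are equal (`m° = N[1/f]`). [folklore] -/
theorem ringHom_ext_O {P : Type*} [CommRing P] {f g : O →+* P}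
    (h : ∀ ν : intN (m := m) V, f (NtoO C ν) = g (NtoO C ν)) : f = g := by
  letI := algNO C
  haveI := isLocalization_O C
  refine IsLocalization.ringHom_ext (Submonoid.powers (fN C)) (RingHom.ext fun ν => ?_)
  exact h ν

/-- **`σ₁ ∘ μO = id`**: the `m°`-structure is compatible with the point. [folklore] -/
theorem σ₁_comp_μO : (σ₁ C e hj hje).comp (μO C e hj hje) = RingHom.id O := by
  refine ringHom_ext_O C fun ν => ?_
  rw [RingHom.comp_apply, μO_NtoO, σ₁_algebraMap, RingHom.id_apply]
  exact Subtype.ext (σDr_θN C e hj hje ν)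

/-- `σ₁(μO a) = a`. [folklore] -/
@[simp] theorem σ₁_μO (a : O) : σ₁ C e hj hje (μO C e hj hje a) = a := by
  have := congrArg (fun f => f a) (σ₁_comp_μO C e hj hje)
  simpa using this

/-- `μO` on `k°`: the structure map `k° → A″_j → D₁`. [folklore] -/
theorem μO_vO (v : V) : μO C e hj hje (C.vO v) =
    algebraMap (C.A'' hj) (D₁ C e hj hje) (C.baseToA'' hj v) := by
  have hv : (C.vO v : O) = NtoO C ⟨algebraMap k m v,
      mem_intN_iff.mpr (isIntegral_algebraMap_of_mem V v.2)⟩ := Subtype.ext rfl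
  rw [hv, μO_NtoO, θN_algebraMap, ← IsScalarTower.algebraMap_apply]

/-- `μO(π) = π`. [folklore] -/
theorem μO_πO : μO C e hj hje C.πO = algebraMap (C.A'' hj) (D₁ C e hj hje) (C.πS hj) :=
  μO_vO C e hj hje ⟨C.π, C.hπV⟩

/-! ### Ambient rings `Ω_S = S ⊗_{A″_j} K` for flat `A″_j`-algebras `S` over `D₀` -/

end D1

section Amb

variable (e : ℕ) {j : ℕ} (hj : C.jH ≤ j) (hje : C.bp + e + 2 * C.Na ≤ j)
variable (S : Type u) [CommRing S] [Algebra (C.A'' hj) S] [Algebra (C.D₀ e hj hje) S]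
  [IsScalarTower (C.A'' hj) (C.D₀ e hj hje) S]

/-- The ambient ring `Ω_S = S ⊗_{A″_j} K` of an `A″_j`-algebra `S`. [folklore] -/
abbrev ΩS : Type u := TensorProduct (C.A'' hj) S K

/-- `ι_S : S → Ω_S`. [folklore] -/
abbrev ιS : S →ₐ[C.A'' hj] ΩS C hj S := Algebra.TensorProduct.includeLeft

/-- `ι_{K,S} : K → Ω_S`. [folklore] -/
abbrev ιKS : K →ₐ[C.A'' hj] ΩS C hj S := Algebra.TensorProduct.includeRight

/-- `ι_S` is injective for `S` flat over the domain `A″_j ⊆ K`. [folklore] -/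
theorem ιS_injective [Module.Flat (C.A'' hj) S] : Function.Injective (ιS C hj S) :=
  Algebra.TensorProduct.includeLeft_injective (S := C.A'' hj) Subtype.val_injective

/-- The transition map `Ω_D → Ω_S`. [folklore] -/
def toΩ : C.ΩD e hj hje →ₐ[C.A'' hj] ΩS C hj S :=
  Algebra.TensorProduct.map (IsScalarTower.toAlgHom (C.A'' hj) (C.D₀ e hj hje) S) (AlgHom.id (C.A'' hj) K)

/-- `Ω_D → Ω_S` on `ι_D`. [folklore] -/
@[simp] theorem toΩ_ιD (x : C.D₀ e hj hje) :
    toΩ C e hj hje S (C.ιD e hj hje x) = ιS C hj S (algebraMap (C.D₀ e hj hje) S x) := by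
  change toΩ C e hj hje S (x ⊗ₜ 1) = (algebraMap _ _ x) ⊗ₜ 1
  rw [toΩ, Algebra.TensorProduct.map_tmul]; rfl

/-- `Ω_D → Ω_S` on `ι_K`. [folklore] -/
@[simp] theorem toΩ_ιK (z : K) : toΩ C e hj hje S (C.ιK e hj hje z) = ιKS C hj S z := by
  change toΩ C e hj hje S (1 ⊗ₜ z) = 1 ⊗ₜ z
  rw [toΩ, Algebra.TensorProduct.map_tmul, map_one]; rfl

/-- `ι_{K,S}` on `A″_j`. [folklore] -/
theorem ιKS_coe (a : C.A'' hj) : ιKS C hj S (a : K) = ιS C hj S (algebraMap (C.A'' hj) S a) := by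
  rw [← Subring.coe_subtype, show (C.A'' hj).subtype a = algebraMap (C.A'' hj) K a from rfl,
    AlgHom.commutes, AlgHom.commutes]

/-- Nonzero elements of `K` are units of `Ω_S`. [folklore] -/
theorem isUnit_ιKS {z : K} (hz : z ≠ 0) : IsUnit (ιKS C hj S z) := (IsUnit.mk0 z hz).map _

/-- **`Ξ_S : m → Ω_S`** (`Ξ` followed by the transition). [folklore] -/
def ΞS : m →+* ΩS C hj S := (toΩ C e hj hje S : C.ΩD e hj hje →+* ΩS C hj S).comp (C.Ξ e hj hje)

/-- `Ξ_S = (Ω_D → Ω_S) ∘ Ξ`. [folklore] -/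
theorem ΞS_apply (a : m) : ΞS C e hj hje S a = toΩ C e hj hje S (C.Ξ e hj hje a) := rfl

/-- Nonzero elements of `m` are units of `Ω_S`. [folklore] -/
theorem isUnit_ΞS {a : m} (ha : a ≠ 0) : IsUnit (ΞS C e hj hje S a) := (IsUnit.mk0 a ha).map _

/-- `Ξ_S` on `k`: `ι_{K,S}`. [folklore] -/
theorem ΞS_algebraMap (c : k) : ΞS C e hj hje S (algebraMap k m c) = ιKS C hj S (algebraMap k K c) := by
  rw [ΞS_apply, C.Ξ_algebraMap, toΩ_ιK]

/-- `Ξ_S(π) = ι_{K,S}(π)`. [folklore] -/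
theorem ΞS_π : ΞS C e hj hje S (algebraMap k m C.π) = ιKS C hj S C.πK := ΞS_algebraMap C e hj hje S C.π

/-- `Ξ_S` on `k°`, through `S`. [folklore] -/
theorem ΞS_algebraMap_V (v : V) : ΞS C e hj hje S (algebraMap k m v) =
    ιS C hj S (algebraMap (C.A'' hj) S (C.baseToA'' hj v)) := by
  rw [ΞS_apply, C.Ξ_algebraMap_V, toΩ_ιD, ← IsScalarTower.algebraMap_apply]

/-- `Ξ_S ∘ θN = ι_S ∘ (D₀ → S) ∘ θN`. [folklore] -/
theorem ΞS_θN (ν : intN (m := m) V) :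
    ΞS C e hj hje S ν = ιS C hj S (algebraMap (C.D₀ e hj hje) S (θN C e hj hje ν)) := by
  rw [ΞS_apply, ← ιD_θN, toΩ_ιD]

/-- Cancellation of powers of `π` in a flat `A″_j`-algebra. [folklore] -/
theorem π_cancel [Module.Flat (C.A'' hj) S] {n : ℕ} {a b : S}
    (h : algebraMap (C.A'' hj) S (C.πS hj ^ n) * a = algebraMap (C.A'' hj) S (C.πS hj ^ n) * b) : a = b := by
  have hπ0 : (C.πS hj ^ n : C.A'' hj) ≠ 0 := pow_ne_zero n (fun h0 => C.πK_ne_zero (congrArg Subtype.val h0))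
  have hreg : IsSMulRegular S (algebraMap (C.A'' hj) S (C.πS hj ^ n)) :=
    IsSMulRegular.of_flat (isLeftRegular_iff.mp (IsRegular.of_ne_zero hπ0).left)
  exact hreg h

/-- Nonzero elements of `A″_j` are non-zero-divisors of a flat `A″_j`-algebra. [folklore] -/
theorem mul_left_cancel_A'' [Module.Flat (C.A'' hj) S] {a : C.A'' hj} (ha : a ≠ 0) {x y : S}
    (h : algebraMap (C.A'' hj) S a * x = algebraMap (C.A'' hj) S a * y) : x = y := by
  have hreg : IsSMulRegular S (algebraMap (C.A'' hj) S a) :=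
    IsSMulRegular.of_flat (isLeftRegular_iff.mp (IsRegular.of_ne_zero ha).left)
  exact hreg h

/-! #### Transition between two levels `S → S′` -/

variable (S' : Type u) [CommRing S'] [Algebra (C.A'' hj) S'] [Algebra (C.D₀ e hj hje) S']
  [IsScalarTower (C.A'' hj) (C.D₀ e hj hje) S'] [Algebra S S'] [IsScalarTower (C.A'' hj) S S']
  [IsScalarTower (C.D₀ e hj hje) S S']

/-- The transition map `Ω_S → Ω_{S′}` along an algebra map `S → S′`. [folklore] -/
def ΩSto : ΩS C hj S →ₐ[C.A'' hj] ΩS C hj S' :=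
  Algebra.TensorProduct.map (IsScalarTower.toAlgHom (C.A'' hj) S S') (AlgHom.id (C.A'' hj) K)

/-- `Ω_S → Ω_{S′}` on `ι_S`. [folklore] -/
@[simp] theorem ΩSto_ιS (x : S) : ΩSto C hj S S' (ιS C hj S x) = ιS C hj S' (algebraMap S S' x) := by
  change ΩSto C hj S S' (x ⊗ₜ 1) = (algebraMap _ _ x) ⊗ₜ 1
  rw [ΩSto, Algebra.TensorProduct.map_tmul]; rfl

/-- `Ω_S → Ω_{S′}` on `ι_K`. [folklore] -/
@[simp] theorem ΩSto_ιKS (z : K) : ΩSto C hj S S' (ιKS C hj S z) = ιKS C hj S' z := by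
  change ΩSto C hj S S' (1 ⊗ₜ z) = 1 ⊗ₜ z
  rw [ΩSto, Algebra.TensorProduct.map_tmul, map_one]; rfl

/-- `Ω_S → Ω_{S′}` after `Ω_D → Ω_S` is `Ω_D → Ω_{S′}`. [folklore] -/
theorem ΩSto_toΩ (w : C.ΩD e hj hje) : ΩSto C hj S S' (toΩ C e hj hje S w) = toΩ C e hj hje S' w := by
  induction w using TensorProduct.induction_on with
  | zero => rw [map_zero, map_zero, map_zero]
  | tmul x z =>
    have hx : (x ⊗ₜ[C.A'' hj] z : C.ΩD e hj hje) = C.ιD e hj hje x * C.ιK e hj hje z := by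
      rw [Algebra.TensorProduct.includeLeft_apply, Algebra.TensorProduct.includeRight_apply,
        Algebra.TensorProduct.tmul_mul_tmul, mul_one, one_mul]
    rw [hx, map_mul, map_mul, map_mul, toΩ_ιD, toΩ_ιK, toΩ_ιD, toΩ_ιK, ΩSto_ιS, ΩSto_ιKS,
      ← IsScalarTower.algebraMap_apply]
  | add x y hx hy => rw [map_add, map_add, hx, hy, map_add]

/-- `Ω_S → Ω_{S′}` on `Ξ_S`: `Ξ_{S′}`. [folklore] -/
@[simp] theorem ΩSto_ΞS (a : m) : ΩSto C hj S S' (ΞS C e hj hje S a) = ΞS C e hj hje S' a := by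
  rw [ΞS_apply, ΩSto_toΩ, ΞS_apply]

end Amb

/-! ### The ambient ring of `D₁` and `ι₁ ∘ μO = Ξ₁` -/

section D1Amb

variable (e : ℕ) {j : ℕ} (hj : C.jH ≤ j) (hje : C.bp + e + 2 * C.Na ≤ j)

/-- **`ι₁ ∘ μO = Ξ₁|_{m°}`** in `Ω₁ = D₁ ⊗_{A″_j} K`. [folklore] -/
theorem ι₁_μO (a : O) : ιS C hj (D₁ C e hj hje) (μO C e hj hje a) = ΞS C e hj hje (D₁ C e hj hje) a := by
  have key : ((ιS C hj (D₁ C e hj hje) : D₁ C e hj hje →+* ΩS C hj (D₁ C e hj hje)).comp (μO C e hj hje)) =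
      (ΞS C e hj hje (D₁ C e hj hje)).comp O.subtype := by
    refine ringHom_ext_O C fun ν => ?_
    rw [RingHom.comp_apply, RingHom.comp_apply, μO_NtoO]
    change ιS C hj (D₁ C e hj hje) (algebraMap _ _ (θN C e hj hje ν)) = ΞS C e hj hje (D₁ C e hj hje) (ν : m)
    rw [ΞS_θN]
  exact congrArg (fun f => f a) key

/-- `μO(c) ≠ 0`-constants act injectively: `ι₁(μO c · x) = Ξ₁ c · ι₁ x`. [folklore] -/
theorem ι₁_μO_mul (c : O) (x : D₁ C e hj hje) :
    ιS C hj (D₁ C e hj hje) (μO C e hj hje c * x) = ΞS C e hj hje (D₁ C e hj hje) c * ιS C hj (D₁ C e hj hje) x := by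
  rw [map_mul, ι₁_μO]

/-- Cancelling a nonzero `m°`-constant in `D₁`: `μO c · x = 0 → x = 0` for `c ≠ 0`. [folklore] -/
theorem eq_zero_of_μO_mul_eq_zero {c : O} (hc : (c : m) ≠ 0) {x : D₁ C e hj hje}
    (h : μO C e hj hje c * x = 0) : x = 0 := by
  apply ιS_injective C hj (D₁ C e hj hje)
  have h1 := congrArg (ιS C hj (D₁ C e hj hje)) h
  rw [ι₁_μO_mul, map_zero] at h1
  rw [map_zero]
  exact (isUnit_ΞS C e hj hje (D₁ C e hj hje) hc).mul_right_eq_zero.mp h1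

end D1Amb

end StepXII

/-! ## XIII. The bridge map `μ : E₀ → D₂` -/

section StepXIII

variable (ε : C.EParams) {e j : ℕ} (H : C.EHyps ε e j) (hBw : C.Bw ≤ j)

/-! ### `μB : m°[X] → D₁` and the Newton coordinate in `D₁` -/

/-- **`μB : m°[X₁,…,X_n] → D₁`**: `m°` through `μO`, `Xᵢ ↦ u′_{D,i} = Tᵢ/π^{j_z}`. [folklore] -/
def μB : MvPolynomial (Fin C.n) O →+* D₁ C e H.hj H.hje :=
  MvPolynomial.eval₂Hom (μO C e H.hj H.hje)
    fun i => algebraMap (C.A'' H.hj) (D₁ C e H.hj H.hje) (C.uD H.hj i)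

/-- `μB` on constants. [folklore] -/
@[simp] theorem μB_C (a : O) : μB C ε H (MvPolynomial.C a) = μO C e H.hj H.hje a :=
  MvPolynomial.eval₂Hom_C _ _ a

/-- `μB` on variables. [folklore] -/
@[simp] theorem μB_X (i : Fin C.n) :
    μB C ε H (MvPolynomial.X i) = algebraMap (C.A'' H.hj) (D₁ C e H.hj H.hje) (C.uD H.hj i) :=
  MvPolynomial.eval₂Hom_X' _ _ i

/-- `σ₁ ∘ μB` is the evaluation at the origin `Xᵢ ↦ 0`. [folklore] -/
theorem σ₁_comp_μB : (σ₁ C e H.hj H.hje).comp (μB C ε H) = MvPolynomial.constantCoeff := by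
  refine MvPolynomial.ringHom_ext (fun a => ?_) (fun i => ?_)
  · rw [RingHom.comp_apply, μB_C, σ₁_μO, MvPolynomial.constantCoeff_C]
  · rw [RingHom.comp_apply, μB_X, MvPolynomial.constantCoeff_X]
    apply Subtype.ext
    rw [σ₁_algebraMap_A'', ZeroMemClass.coe_zero]
    exact C.ev_uD H.hj i

/-- The Newton coordinate `W_D` in `D₁`. [folklore] -/
def WD₁ : D₁ C e H.hj H.hje := algebraMap (C.D₀ e H.hj H.hje) (D₁ C e H.hj H.hje) (C.WD e H.hj H.hje hBw ε.r)

/-- `σ₁(W_D) = 0`. [folklore] -/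
@[simp] theorem σ₁_WD₁ : σ₁ C e H.hj H.hje (WD₁ C ε H hBw) = 0 := by
  rw [WD₁, σ₁_algebraMap, C.σDr_WD]

/-- `σ₁` of a `m°[X]`-polynomial evaluated at `W_D`: its value at the origin. [folklore] -/
theorem σ₁_eval₂ (Ψ : (MvPolynomial (Fin C.n) O)[X]) :
    σ₁ C e H.hj H.hje (Ψ.eval₂ (μB C ε H) (WD₁ C ε H hBw)) =
      letI := C.algPt; Polynomial.aeval (0 : O) Ψ := by
  letI := C.algPt
  rw [Polynomial.hom_eval₂, σ₁_comp_μB, σ₁_WD₁, Polynomial.aeval_def]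
  rfl

/-! ### The `D`-side evaluation chain -/

section Chain

variable (hjW : C.Bw + (C.N₀ + ε.r + C.dΘ) ≤ j)

/-- `lin` at `W_D`: `w₀′ + c₀′π^r W_D`. [folklore] -/
theorem eval₂_lin : (C.lin ε).eval₂ (μB C ε H) (WD₁ C ε H hBw) =
    μO C e H.hj H.hje C.w₀'O + μO C e H.hj H.hje (C.c₀' * C.πO ^ ε.r) * WD₁ C ε H hBw := by
  rw [lin, eval₂_add, eval₂_C, eval₂_mul, eval₂_C, eval₂_X, μB_C, μB_C]

include hjW in
/-- **(b) in `Ω₁`**: `ι₁(w₀′ + c₀′π^r W_D) = ι_K(w′)`. [folklore] -/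
theorem ιS_eval₂_lin : ιS C H.hj (D₁ C e H.hj H.hje) ((C.lin ε).eval₂ (μB C ε H) (WD₁ C ε H hBw)) =
    ιKS C H.hj (D₁ C e H.hj H.hje) (C.w' : K) := by
  have hb := congrArg (toΩ C e H.hj H.hje (D₁ C e H.hj H.hje)) (C.ιD_WD e H.hj H.hje hBw ε.r hjW)
  rw [map_mul, map_mul, map_pow, map_sub, toΩ_ιK, toΩ_ιD] at hb
  rw [eval₂_lin, map_add, map_mul, ι₁_μO, ι₁_μO, Subring.coe_mul, SubmonoidClass.coe_pow, coe_πO,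
    map_mul, map_pow]
  rw [ΞS_apply, ΞS_apply, ΞS_apply, WD₁, show ((C.w₀'O : O) : m) = C.w₀' from rfl]
  linear_combination hb

/-- The coefficient ring homomorphism of the chain, `K`-side: `k°[X] → Rh → K → Ω_S`. [folklore] -/
theorem ringHom_chain (S : Type u) [CommRing S] [Algebra (C.A'' H.hj) S]
    (χ : MvPolynomial (Fin C.n) V →+* ΩS C H.hj S)
    (hC : ∀ v : V, χ (MvPolynomial.C v) = ιKS C H.hj S (algebraMap k K v))
    (hX : ∀ i, χ (MvPolynomial.X i) = ιKS C H.hj S (C.T i)) :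
    χ = ((ιKS C H.hj S : K →+* ΩS C H.hj S).comp ((C.Rh.val : C.Rh →+* K).comp
      ((algebraMap (MvPolynomial (Fin C.n) k) C.Rh).comp (MvPolynomial.map (algebraMap V k))))) := by
  refine MvPolynomial.ringHom_ext (fun v => ?_) (fun i => ?_)
  · rw [hC]
    simp only [RingHom.coe_comp, Function.comp_apply, MvPolynomial.map_C]
    rw [← MvPolynomial.algebraMap_eq, ← IsScalarTower.algebraMap_apply]
    rfl
  · rw [hX]
    simp only [RingHom.coe_comp, Function.comp_apply, MvPolynomial.map_X]
    change _ = ιKS C H.hj S ((algebraMap (MvPolynomial (Fin C.n) k) C.Rh (MvPolynomial.X i) : C.Rh) : K)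
    rw [C.algebraMap_X_coe]

/-- The `K`-side of the chain: `ι_K(Ψ_k(T, w′))` as an `eval₂`. [folklore] -/
theorem ιKS_aeval_w' (S : Type u) [CommRing S] [Algebra (C.A'' H.hj) S]
    (ΨV : (MvPolynomial (Fin C.n) V)[X]) :
    ιKS C H.hj S ((Polynomial.aeval C.w' (ΨV.map (MvPolynomial.map (algebraMap V k))) : C.Rh) : K) =
      ΨV.eval₂ ((ιKS C H.hj S : K →+* ΩS C H.hj S).comp ((C.Rh.val : C.Rh →+* K).comp
        ((algebraMap (MvPolynomial (Fin C.n) k) C.Rh).comp (MvPolynomial.map (algebraMap V k)))))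
        (ιKS C H.hj S (C.w' : K)) := by
  rw [Polynomial.aeval_def, Polynomial.eval₂_map,
    show ((Polynomial.eval₂ ((algebraMap (MvPolynomial (Fin C.n) k) C.Rh).comp
      (MvPolynomial.map (algebraMap V k))) C.w' ΨV : C.Rh) : K) =
      (C.Rh.val : C.Rh →+* K) (Polynomial.eval₂ ((algebraMap (MvPolynomial (Fin C.n) k) C.Rh).comp
      (MvPolynomial.map (algebraMap V k))) C.w' ΨV) from rfl,
    Polynomial.hom_eval₂,
    show (ιKS C H.hj S) (Polynomial.eval₂ _ _ ΨV) = (ιKS C H.hj S : K →+* ΩS C H.hj S)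
      (Polynomial.eval₂ _ _ ΨV) from rfl,
    Polynomial.hom_eval₂]
  rfl

include hjW in
/-- **The `D`-side evaluation chain**: for a `k°`-polynomial `Ψ`,
`ι₁(Ψ_O(π^{j_z} u′_D, w₀′ + c₀′ π^r W_D)) = ι_K(Ψ_k(T, w′))`. [folklore] -/
theorem ιS_evalD (ΨV : (MvPolynomial (Fin C.n) V)[X]) :
    ιS C H.hj (D₁ C e H.hj H.hje)
      (((Polydisc.zpoly (C.πO ^ ε.jz) (ΨV.map (MvPolynomial.map C.vO))).comp (C.lin ε)).eval₂
        (μB C ε H) (WD₁ C ε H hBw)) =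
    ιKS C H.hj (D₁ C e H.hj H.hje)
      ((Polynomial.aeval C.w' (ΨV.map (MvPolynomial.map (algebraMap V k))) : C.Rh) : K) := by
  rw [Polynomial.eval₂_comp, Polydisc.zpoly, Polynomial.eval₂_map, Polynomial.eval₂_map,
    show (ιS C H.hj (D₁ C e H.hj H.hje)) (Polynomial.eval₂ _ _ ΨV) =
      (ιS C H.hj (D₁ C e H.hj H.hje) : D₁ C e H.hj H.hje →+* _) (Polynomial.eval₂ _ _ ΨV) from rfl,
    Polynomial.hom_eval₂, ιKS_aeval_w' C ε H]
  have hpt : (ιS C H.hj (D₁ C e H.hj H.hje) : D₁ C e H.hj H.hje →+* _)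
      (Polynomial.eval₂ (μB C ε H) (WD₁ C ε H hBw) (C.lin ε)) =
      ιKS C H.hj (D₁ C e H.hj H.hje) (C.w' : K) := ιS_eval₂_lin C ε H hBw hjW
  rw [hpt]
  congr 1
  refine ringHom_chain C ε H (D₁ C e H.hj H.hje) _ (fun v => ?_) (fun i => ?_)
  · simp only [RingHom.coe_comp, Function.comp_apply, MvPolynomial.map_C, AlgHom.toRingHom_eq_coe,
      RingHom.coe_coe, Polydisc.zoomX_C, μB_C]
    change ιS C H.hj (D₁ C e H.hj H.hje) (μO C e H.hj H.hje (C.vO v)) = _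
    rw [ι₁_μO]
    exact ΞS_algebraMap C e H.hj H.hje (D₁ C e H.hj H.hje) (v : k)
  · simp only [RingHom.coe_comp, Function.comp_apply, MvPolynomial.map_X, AlgHom.toRingHom_eq_coe,
      RingHom.coe_coe, Polydisc.zoomX_X, map_mul, μB_C, μB_X]
    rw [ι₁_μO, SubmonoidClass.coe_pow, coe_πO, map_pow, ΞS_π, ← ιKS_coe, ← map_pow,
      ← map_mul, C.πK_pow_mul_uD H.hj ε.jz H.hjc i]

include hjW in
/-- `F_O(π^{j_z}u′_D, w₀′ + c₀′π^r W_D) = 0` in `D₁`. [folklore] -/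
theorem eval₂_FO : ((Polydisc.zpoly (C.πO ^ ε.jz) C.FO).comp (C.lin ε)).eval₂ (μB C ε H) (WD₁ C ε H hBw) = 0 := by
  apply ιS_injective C H.hj (D₁ C e H.hj H.hje)
  rw [FO, ιS_evalD C ε H hBw hjW, C.map_FV, C.aeval_w'_F₁, map_zero, ZeroMemClass.coe_zero, map_zero]

include hjW in
/-- **`F̃(u′_D, W_D) = 0` in `D₁`.** [folklore] -/
theorem eval₂_Ft : (C.Ft ε).eval₂ (μB C ε H) (WD₁ C ε H hBw) = 0 := by
  have h := congrArg (fun q => Polynomial.eval₂ (μB C ε H) (WD₁ C ε H hBw) q) (C.Ft_spec ε)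
  simp only [eval₂_mul, eval₂_C, μB_C] at h
  rw [eval₂_FO C ε H hBw hjW] at h
  refine eq_zero_of_μO_mul_eq_zero C e H.hj H.hje (c := C.c₀' ^ 2 * C.πO ^ ε.r) ?_ h
  rw [Subring.coe_mul, SubmonoidClass.coe_pow, SubmonoidClass.coe_pow, coe_πO]
  exact mul_ne_zero (pow_ne_zero 2 C.c₀'_ne_zero) (pow_ne_zero _ C.π_ne_zero_m)

end Chain

/-! ### The roof `D₂ = D₁[1/g_E(u′_D, W_D)]` and `μ : E₀ → D₂` -/

/-- The localized polynomial of the polydisc chart at `(u′_D, W_D)`. [folklore] -/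
def gEW : D₁ C e H.hj H.hje := (C.PE ε).g.eval₂ (μB C ε H) (WD₁ C ε H hBw)

/-- `σ₁(gEW)` is a unit of `m°` (it is the value of `g_E` at the `m°`-point of `E₀`). [folklore] -/
theorem isUnit_σ₁_gEW : IsUnit (σ₁ C e H.hj H.hje (gEW C ε H hBw)) := by
  rw [gEW, σ₁_eval₂]
  exact (C.hasMap_pt ε).2

/-- **The roof ring `D₂ = D₁[1/gEW]`.** [folklore] -/
abbrev D₂ : Type u := Localization.Away (gEW C ε H hBw)

/-- `D₂` is smooth over `D₁`. [folklore] -/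
instance smooth_D₂_D₁ : Algebra.Smooth (D₁ C e H.hj H.hje) (D₂ C ε H hBw) :=
  Algebra.Smooth.of_isLocalization_Away (gEW C ε H hBw)

/-- **`D₂` is smooth over `A″_j`.** [folklore] -/
instance smooth_D₂ : Algebra.Smooth (C.A'' H.hj) (D₂ C ε H hBw) :=
  Algebra.Smooth.comp (C.A'' H.hj) (D₁ C e H.hj H.hje) (D₂ C ε H hBw)

/-- `D₂` is smooth over `D₀`. [folklore] -/
instance smooth_D₂_D₀ : Algebra.Smooth (C.D₀ e H.hj H.hje) (D₂ C ε H hBw) :=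
  Algebra.Smooth.comp (C.D₀ e H.hj H.hje) (D₁ C e H.hj H.hje) (D₂ C ε H hBw)

/-- The point `σ₂ : D₂ → m°`. [folklore] -/
def σ₂ : D₂ C ε H hBw →+* O :=
  IsLocalization.Away.lift (gEW C ε H hBw) (g := σ₁ C e H.hj H.hje) (isUnit_σ₁_gEW C ε H hBw)

/-- `σ₂` extends `σ₁`. [folklore] -/
@[simp] theorem σ₂_algebraMap (x : D₁ C e H.hj H.hje) :
    σ₂ C ε H hBw (algebraMap (D₁ C e H.hj H.hje) (D₂ C ε H hBw) x) = σ₁ C e H.hj H.hje x :=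
  IsLocalization.Away.lift_eq _ _ x

/-- `σ₂` extends `σ_D`. [folklore] -/
@[simp] theorem σ₂_algebraMap_D₀ (x : C.D₀ e H.hj H.hje) :
    σ₂ C ε H hBw (algebraMap (C.D₀ e H.hj H.hje) (D₂ C ε H hBw) x) = C.σDr e H.hj H.hje x := by
  rw [IsScalarTower.algebraMap_apply (C.D₀ e H.hj H.hje) (D₁ C e H.hj H.hje) (D₂ C ε H hBw),
    σ₂_algebraMap, σ₁_algebraMap]

/-- `σ₂` on `A″_j`: the value at the point. [folklore] -/
theorem σ₂_algebraMap_A'' (a : C.A'' H.hj) :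
    (σ₂ C ε H hBw (algebraMap (C.A'' H.hj) (D₂ C ε H hBw) a) : m) = ev φ (a : K) := by
  rw [IsScalarTower.algebraMap_apply (C.A'' H.hj) (D₁ C e H.hj H.hje) (D₂ C ε H hBw), σ₂_algebraMap,
    σ₁_algebraMap_A'']

/-- **`μB₂ : m°[X] → D₂`** and the `m°[X]`-algebra structure of the roof. [folklore] -/
def μB₂ : MvPolynomial (Fin C.n) O →+* D₂ C ε H hBw :=
  (algebraMap (D₁ C e H.hj H.hje) (D₂ C ε H hBw)).comp (μB C ε H)

/-- The roof as an `m°[X₁,…,X_n]`-algebra. [folklore] -/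
instance algBD₂ : Algebra (MvPolynomial (Fin C.n) O) (D₂ C ε H hBw) := (μB₂ C ε H hBw).toAlgebra

/-- The structure map of `D₂` over `m°[X]` is `μB₂`. [folklore] -/
theorem algebraMap_BD₂ : algebraMap (MvPolynomial (Fin C.n) O) (D₂ C ε H hBw) = μB₂ C ε H hBw := rfl

/-- `μO₂ : m° → D₂`. [folklore] -/
def μO₂ : O →+* D₂ C ε H hBw := (algebraMap (D₁ C e H.hj H.hje) (D₂ C ε H hBw)).comp (μO C e H.hj H.hje)

/-- `μB₂` on constants. [folklore] -/
@[simp] theorem μB₂_C (a : O) : μB₂ C ε H hBw (MvPolynomial.C a) = μO₂ C ε H hBw a := by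
  rw [μB₂, RingHom.comp_apply, μB_C]; rfl

/-- `μB₂` on variables. [folklore] -/
@[simp] theorem μB₂_X (i : Fin C.n) :
    μB₂ C ε H hBw (MvPolynomial.X i) = algebraMap (C.A'' H.hj) (D₂ C ε H hBw) (C.uD H.hj i) := by
  rw [μB₂, RingHom.comp_apply, μB_X, ← IsScalarTower.algebraMap_apply]

/-- `σ₂ ∘ μO₂ = id`. [folklore] -/
@[simp] theorem σ₂_μO₂ (a : O) : σ₂ C ε H hBw (μO₂ C ε H hBw a) = a := by
  rw [μO₂, RingHom.comp_apply, σ₂_algebraMap, σ₁_μO]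

/-- `σ₂ ∘ μB₂` is the evaluation at the origin. [folklore] -/
theorem σ₂_comp_μB₂ : (σ₂ C ε H hBw).comp (μB₂ C ε H hBw) = MvPolynomial.constantCoeff := by
  rw [μB₂, ← RingHom.comp_assoc, show (σ₂ C ε H hBw).comp (algebraMap (D₁ C e H.hj H.hje) (D₂ C ε H hBw)) =
    σ₁ C e H.hj H.hje from RingHom.ext fun x => σ₂_algebraMap C ε H hBw x, σ₁_comp_μB]

/-- The Newton coordinate in the roof. [folklore] -/
def WD₂ : D₂ C ε H hBw := algebraMap (D₁ C e H.hj H.hje) (D₂ C ε H hBw) (WD₁ C ε H hBw)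

/-- `σ₂(W_D) = 0`. [folklore] -/
@[simp] theorem σ₂_WD₂ : σ₂ C ε H hBw (WD₂ C ε H hBw) = 0 := by
  rw [WD₂, σ₂_algebraMap, σ₁_WD₁]

/-- Evaluating `m°[X]`-polynomials at `W_D` in the roof. [folklore] -/
theorem aeval_WD₂ (Ψ : (MvPolynomial (Fin C.n) O)[X]) :
    Polynomial.aeval (WD₂ C ε H hBw) Ψ =
      algebraMap (D₁ C e H.hj H.hje) (D₂ C ε H hBw) (Ψ.eval₂ (μB C ε H) (WD₁ C ε H hBw)) := by
  rw [Polynomial.aeval_def, algebraMap_BD₂, μB₂, WD₂, Polynomial.hom_eval₂]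

section Mu

variable (hjW : C.Bw + (C.N₀ + ε.r + C.dΘ) ≤ j)

include hjW in
/-- **`W_D` is a point of the polydisc pair in the roof**: `F̃(W_D) = 0`, `g_E(W_D)` a unit.
[folklore] -/
theorem hasMap_WD₂ : (C.PE ε).HasMap (WD₂ C ε H hBw) := by
  refine ⟨?_, ?_⟩
  · change Polynomial.aeval (WD₂ C ε H hBw) (C.Ft ε) = 0
    rw [aeval_WD₂, eval₂_Ft C ε H hBw hjW, map_zero]
  · rw [aeval_WD₂]
    exact IsLocalization.Away.algebraMap_isUnit (gEW C ε H hBw)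

/-- **The bridge map `μ : E₀ → D₂`** (`m°[X]`-algebra map with `W ↦ W_D`). [folklore] -/
def μ : C.E₀ ε →ₐ[MvPolynomial (Fin C.n) O] D₂ C ε H hBw :=
  (C.PE ε).lift (WD₂ C ε H hBw) (hasMap_WD₂ C ε H hBw hjW)

/-- `μ(W) = W_D`. [folklore] -/
@[simp] theorem μ_W : μ C ε H hBw hjW (C.W ε) = WD₂ C ε H hBw := (C.PE ε).lift_X _ _

/-- `μ` on `m°[X]`. [folklore] -/
@[simp] theorem μ_algebraMap (q : MvPolynomial (Fin C.n) O) :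
    μ C ε H hBw hjW (algebraMap (MvPolynomial (Fin C.n) O) (C.E₀ ε) q) = μB₂ C ε H hBw q :=
  (μ C ε H hBw hjW).commutes q

/-- `μ` on `m°`. [folklore] -/
@[simp] theorem μ_algebraMap_O (a : O) : μ C ε H hBw hjW (algebraMap O (C.E₀ ε) a) = μO₂ C ε H hBw a := by
  rw [IsScalarTower.algebraMap_apply O (MvPolynomial (Fin C.n) O) (C.E₀ ε), μ_algebraMap,
    MvPolynomial.algebraMap_eq, μB₂_C]

/-- `μ` on the polydisc coordinates: `u′ᵢ ↦ u′_{D,i}`. [folklore] -/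
@[simp] theorem μ_uE (i : Fin C.n) :
    μ C ε H hBw hjW (C.uE ε i) = algebraMap (C.A'' H.hj) (D₂ C ε H hBw) (C.uD H.hj i) := by
  rw [uE, μ_algebraMap, μB₂_X]

/-- `μ` of a polynomial in `W`. [folklore] -/
theorem μ_aeval_W (Ψ : (MvPolynomial (Fin C.n) O)[X]) :
    μ C ε H hBw hjW (Polynomial.aeval (C.W ε) Ψ) =
      algebraMap (D₁ C e H.hj H.hje) (D₂ C ε H hBw) (Ψ.eval₂ (μB C ε H) (WD₁ C ε H hBw)) := by
  rw [← Polynomial.aeval_algHom_apply, μ_W, aeval_WD₂]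

/-- **`σ₂ ∘ μ = σ_E`**: the bridge map respects the `m°`-points. [folklore] -/
theorem σ₂_comp_μ : (σ₂ C ε H hBw).comp (μ C ε H hBw hjW : C.E₀ ε →+* D₂ C ε H hBw) = C.σE ε := by
  letI := C.algPt
  -- both sides are `m°[X]`-algebra maps `E₀ → m°` for the point structure; compare on `W`
  let s₂ : D₂ C ε H hBw →ₐ[MvPolynomial (Fin C.n) O] O :=
    { toRingHom := σ₂ C ε H hBw
      commutes' := fun q => by
        change σ₂ C ε H hBw (μB₂ C ε H hBw q) = MvPolynomial.constantCoeff q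
        rw [← RingHom.comp_apply, σ₂_comp_μB₂] }
  have key : s₂.comp (μ C ε H hBw hjW) = (C.PE ε).lift (0 : O) (C.hasMap_pt ε) := by
    refine EtalePair.hom_ext ?_
    rw [AlgHom.comp_apply, EtalePair.lift_X]
    change σ₂ C ε H hBw (μ C ε H hBw hjW (C.W ε)) = 0
    rw [μ_W, σ₂_WD₂]
  exact congrArg AlgHom.toRingHom key

/-- `σ₂(μ x) = σ_E(x)`. [folklore] -/
@[simp] theorem σ₂_μ (x : C.E₀ ε) : σ₂ C ε H hBw (μ C ε H hBw hjW x) = C.σE ε x := by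
  rw [← σ₂_comp_μ C ε H hBw hjW]; rfl

/-! ### The mirror lemma: `ι₂(μ(zE z)) = ι_K(z)` -/

/-- `ι₂ ∘ μO₂ = Ξ₂|_{m°}`. [folklore] -/
theorem ιS_μO₂ (a : O) :
    ιS C H.hj (D₂ C ε H hBw) (μO₂ C ε H hBw a) = ΞS C e H.hj H.hje (D₂ C ε H hBw) a := by
  rw [μO₂, RingHom.comp_apply, ← ΩSto_ιS C H.hj (D₁ C e H.hj H.hje) (D₂ C ε H hBw), ι₁_μO,
    ΩSto_ΞS]

/-- **The evaluation chain in the roof**: `ι₂(μ(Ψ_O(π^{j_z}u′, w₀′ + c₀′π^r W))) = ι_K(Ψ_k(T, w′))`.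
[folklore] -/
theorem ιS_μ_evalE (ΨV : (MvPolynomial (Fin C.n) V)[X]) :
    ιS C H.hj (D₂ C ε H hBw) (μ C ε H hBw hjW (C.evalE ε (ΨV.map (MvPolynomial.map C.vO)))) =
      ιKS C H.hj (D₂ C ε H hBw)
        ((Polynomial.aeval C.w' (ΨV.map (MvPolynomial.map (algebraMap V k))) : C.Rh) : K) := by
  rw [evalE, μ_aeval_W, ← ΩSto_ιS C H.hj (D₁ C e H.hj H.hje) (D₂ C ε H hBw),
    ιS_evalD C ε H hBw hjW, ΩSto_ιKS]

omit [Algebra k K] in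
/-- The ring identity behind `ιE_aeval_W_Zt` and its mirror, in an arbitrary commutative ring
(so that the normalization runs on light types). [folklore] -/
theorem key_identity {R : Type*} [CommRing R] {p κ P Q Zw Gw s : R} {a N aG Ng : ℕ}
    (EQ1 : P * p ^ (N * aG) = p ^ a * s * Q ^ N) (EQ2 : p ^ (a + N * Ng) * Zw = κ ^ N * p ^ (N * aG) * P)
    (EQ3N : p ^ (Ng * N) * Gw ^ N = κ ^ N * Q ^ N) :
    p ^ (a + N * Ng) * κ ^ N * Zw = p ^ (a + N * Ng) * κ ^ N * (s * Gw ^ N) := by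
  have hc : (p ^ (Ng * N) : R) = p ^ (N * Ng) := by rw [Nat.mul_comm]
  rw [hc] at EQ3N
  linear_combination κ ^ N * EQ2 + κ ^ (2 * N) * EQ1 - p ^ a * s * κ ^ N * EQ3N

/-- **`ι₂(μ(Ž_z(W))) = ι_K(z) · ι₂(μ(Ğ(W)))^{N_z}`** (mirror of `ιE_aeval_W_Zt`). [folklore] -/
theorem ιS_μ_aeval_W_Zt (z : C.Rh) (hz : C.φh z ∈ O) (hb : C.repb z ≤ ε.r) :
    ιS C H.hj (D₂ C ε H hBw) (μ C ε H hBw hjW (Polynomial.aeval (C.W ε) (C.Zt ε z hz))) =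
      ιKS C H.hj (D₂ C ε H hBw) (z : K) *
        ιS C H.hj (D₂ C ε H hBw) (μ C ε H hBw hjW (Polynomial.aeval (C.W ε) (C.Gt ε))) ^ C.repN z := by
  -- the three equations
  have EQ1 := congrArg (fun y : C.Rh => ιKS C H.hj (D₂ C ε H hBw) (y : K)) (C.aeval_w'_repΦ₁ z)
  simp only [MulMemClass.coe_mul, SubmonoidClass.coe_pow, map_mul, map_pow, C.algebraMap_Rh_coe] at EQ1
  rw [← C.map_repΦV, ← ιS_μ_evalE C ε H hBw hjW, ← repΦO, ← C.map_GV, ← ιS_μ_evalE C ε H hBw hjW,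
    ← GO] at EQ1
  have EQ2 := congrArg (fun x => ιS C H.hj (D₂ C ε H hBw) (μ C ε H hBw hjW x)) (C.Zt_spec_W ε z hz hb)
  have EQ3 := congrArg (fun x => ιS C H.hj (D₂ C ε H hBw) (μ C ε H hBw hjW x)) (C.Gt_spec_W ε)
  simp only [map_mul, μ_algebraMap, μB₂_C, ιS_μO₂] at EQ2 EQ3
  simp only [SubmonoidClass.coe_pow, coe_πO, coe_κ₀O, map_pow] at EQ2 EQ3
  rw [ΞS_π] at EQ2 EQ3
  rw [← πK] at EQ1
  have EQ3N := congrArg (fun x => x ^ C.repN z) EQ3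
  simp only [mul_pow, ← pow_mul] at EQ3N
  have hu : IsUnit (ιKS C H.hj (D₂ C ε H hBw) C.πK ^ C.repb z *
      ΞS C e H.hj H.hje (D₂ C ε H hBw) C.κ₀ ^ C.repN z) :=
    IsUnit.mul ((isUnit_ιKS C H.hj (D₂ C ε H hBw) C.πK_ne_zero).pow _)
      ((isUnit_ΞS C e H.hj H.hje (D₂ C ε H hBw) (fun h0 => C.κ₀O_ne_zero (Subtype.ext h0))).pow _)
  exact hu.mul_left_cancel (key_identity EQ1 EQ2 EQ3N)

/-- **The mirror lemma `ι₂(μ(zE z)) = ι_K(z)`** (for `b_z ≤ r`). [folklore] -/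
theorem ιS_μ_zE (z : C.Rh) (hz : C.φh z ∈ O) (hb : C.repb z ≤ ε.r) :
    ιS C H.hj (D₂ C ε H hBw) (μ C ε H hBw hjW (C.zE ε z hz)) = ιKS C H.hj (D₂ C ε H hBw) (z : K) := by
  rw [zE, Units.val_pow_eq_pow_val, map_mul, map_pow, map_mul, map_pow,
    ιS_μ_aeval_W_Zt C ε H hBw hjW z hz hb, mul_assoc, ← mul_pow, ← map_mul, ← map_mul, ← coe_GtWu,
    Units.mul_inv, map_one, map_one, one_pow, mul_one]

/-- **`μ(zE z) = z`** for `z ∈ A″_j ∩ Rh` (the honest preimages go back to the functions).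
[folklore] -/
theorem μ_zE {z : K} (hzA : z ∈ C.A'' H.hj) (hzR : z ∈ C.Rh) (hz : C.φh ⟨z, hzR⟩ ∈ O)
    (hb : C.repb ⟨z, hzR⟩ ≤ ε.r) :
    μ C ε H hBw hjW (C.zE ε ⟨z, hzR⟩ hz) = algebraMap (C.A'' H.hj) (D₂ C ε H hBw) ⟨z, hzA⟩ := by
  apply ιS_injective C H.hj (D₂ C ε H hBw)
  rw [ιS_μ_zE C ε H hBw hjW _ hz hb, ← ιKS_coe]

end Mu

end StepXIII

/-! ## XIV. `μ ∘ λ₀ = id`, `μ(Z_E) = Z`, and `μ₁ : E₁ → D₂` -/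

section StepXIV

/-! ### `Frac(A₀) = K` in usable form -/

/-- **`Frac(A₀) = K`**: every `z ∈ K` has a nonzero multiplier `b ∈ A₀ = k°[f]` with `bz ∈ A₀`
(`Frac A = K`, and `π`-bounded denominators `k[A] = A₀[1/π]`). [folklore] -/
theorem exists_mul_mem_A₀ (z : K) : ∃ b ∈ C.A₀, b ≠ 0 ∧ b * z ∈ C.A₀ := by
  obtain ⟨a, ha, b, hb, rfl⟩ := C.hfrac z
  by_cases hb0 : b = 0
  · exact ⟨1, C.A₀.one_mem, one_ne_zero, by rw [hb0, div_zero, mul_zero]; exact C.A₀.zero_mem⟩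
  obtain ⟨N, hN⟩ := C.hden a (Algebra.subset_adjoin ha)
  obtain ⟨M, hM⟩ := C.hden b (Algebra.subset_adjoin hb)
  refine ⟨C.πK ^ N * (C.πK ^ M * b), C.A₀.mul_mem (C.A₀.pow_mem C.πK_mem_A₀ N) hM,
    mul_ne_zero (pow_ne_zero N C.πK_ne_zero) (mul_ne_zero (pow_ne_zero M C.πK_ne_zero) hb0), ?_⟩
  have : C.πK ^ N * (C.πK ^ M * b) * (a / b) = C.πK ^ M * (C.πK ^ N * a) := by
    field_simp
  rw [this]
  exact C.A₀.mul_mem (C.A₀.pow_mem C.πK_mem_A₀ M) hN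

variable (ε : C.EParams) {e j : ℕ} (H : C.EHyps ε e j) (hBw : C.Bw ≤ j)
  (hjW : C.Bw + (C.N₀ + ε.r + C.dΘ) ≤ j)

/-! ### (P1) `μ ∘ λ₀` is the structure map -/

/-- `λ₀` on `k°`-constants. [folklore] -/
theorem lam₀_baseToA'' (v : V) : C.lam₀ ε H (C.baseToA'' H.hj v) = algebraMap O (C.E₀ ε) (C.vO v) := by
  refine C.lam₀_of_mem_A₀ ε H (C.algebraMap_mem_A₀ v.2) ?_
  rw [← C.ιm_coe ε, show (⟨algebraMap k K v, C.A₀_subset_Rh (C.algebraMap_mem_A₀ v.2)⟩ : C.Rh) =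
    algebraMap k C.Rh (v : k) from Subtype.ext rfl, ψE_algebraMap_k]
  rfl

include hjW in
/-- **(P1) on `A₀`**: `μ(λ₀ z) = z` for `z ∈ A₀ = k°[f]`. [folklore] -/
theorem μ_lam₀_of_mem_A₀ {z : K} (hz : z ∈ C.A₀) (hz' : z ∈ C.A'' H.hj) :
    μ C ε H hBw hjW (C.lam₀ ε H ⟨z, hz'⟩) = algebraMap (C.A'' H.hj) (D₂ C ε H hBw) ⟨z, hz'⟩ := by
  change z ∈ Subring.closure ((baseRing K V : Set K) ∪ ↑C.f) at hz
  induction hz using Subring.closure_induction with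
  | mem z hz =>
    rcases hz with ⟨c, hc, rfl⟩ | hz
    · have h1 := lam₀_baseToA'' C ε H ⟨c, hc⟩
      have h2 : (⟨algebraMap k K c, hz'⟩ : C.A'' H.hj) = C.baseToA'' H.hj ⟨c, hc⟩ := Subtype.ext rfl
      rw [h2, h1, μ_algebraMap_O, μO₂, RingHom.comp_apply, μO_vO, ← IsScalarTower.algebraMap_apply]
    · have hzA : z ∈ C.A₀ := C.f_subset_A₀ hz
      rw [C.lam₀_of_mem_A₀ ε H hzA (C.ιE_zE ε _ (C.φh_mem_O_of_mem_A₀ hzA) (H.hfr z hz)),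
        μ_zE C ε H hBw hjW hz' (C.A₀_subset_Rh hzA) _ (H.hfr z hz)]
  | one =>
    rw [show (⟨(1 : K), hz'⟩ : C.A'' H.hj) = 1 from rfl, map_one, map_one, map_one]
  | zero =>
    rw [show (⟨(0 : K), hz'⟩ : C.A'' H.hj) = 0 from rfl, map_zero, map_zero, map_zero]
  | add x y hx hy ihx ihy =>
    have hxA : x ∈ C.A'' H.hj := C.A₀_subset_A'' H.hj hx
    have hyA : y ∈ C.A'' H.hj := C.A₀_subset_A'' H.hj hy
    rw [show (⟨x + y, hz'⟩ : C.A'' H.hj) = ⟨x, hxA⟩ + ⟨y, hyA⟩ from rfl, map_add, map_add, map_add,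
      ihx hxA, ihy hyA]
  | neg x hx ihx =>
    have hxA : x ∈ C.A'' H.hj := C.A₀_subset_A'' H.hj hx
    rw [show (⟨-x, hz'⟩ : C.A'' H.hj) = -⟨x, hxA⟩ from rfl, map_neg, map_neg, map_neg, ihx hxA]
  | mul x y hx hy ihx ihy =>
    have hxA : x ∈ C.A'' H.hj := C.A₀_subset_A'' H.hj hx
    have hyA : y ∈ C.A'' H.hj := C.A₀_subset_A'' H.hj hy
    rw [show (⟨x * y, hz'⟩ : C.A'' H.hj) = ⟨x, hxA⟩ * ⟨y, hyA⟩ from rfl, map_mul, map_mul, map_mul,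
      ihx hxA, ihy hyA]

include hjW in
/-- **(P1) `μ ∘ λ₀ = A″_j → D₂`.** [folklore] -/
theorem μ_lam₀ (a : C.A'' H.hj) :
    μ C ε H hBw hjW (C.lam₀ ε H a) = algebraMap (C.A'' H.hj) (D₂ C ε H hBw) a := by
  obtain ⟨b, hbA, hb0, hbz⟩ := exists_mul_mem_A₀ C (a : K)
  have hbA' : b ∈ C.A'' H.hj := C.A₀_subset_A'' H.hj hbA
  set bS : C.A'' H.hj := ⟨b, hbA'⟩
  have hbS0 : bS ≠ 0 := fun h0 => hb0 (congrArg Subtype.val h0)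
  have hprod : (⟨b * a, C.A₀_subset_A'' H.hj hbz⟩ : C.A'' H.hj) = bS * a := rfl
  have h1 := μ_lam₀_of_mem_A₀ C ε H hBw hjW hbz (C.A₀_subset_A'' H.hj hbz)
  rw [hprod, map_mul, map_mul, map_mul, μ_lam₀_of_mem_A₀ C ε H hBw hjW hbA hbA'] at h1
  exact mul_left_cancel_A'' C H.hj (D₂ C ε H hBw) hbS0 h1

include hjW in
/-- (P1) as an identity of ring homomorphisms. [folklore] -/
theorem μ_comp_lam₀ : (μ C ε H hBw hjW : C.E₀ ε →+* D₂ C ε H hBw).comp (C.lam₀ ε H) =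
    algebraMap (C.A'' H.hj) (D₂ C ε H hBw) :=
  RingHom.ext fun a => μ_lam₀ C ε H hBw hjW a

/-! ### (P2) `μ(Z_E) = Z` -/

/-- `t ∈ A″_j` as the element `tK`. [folklore] -/
theorem tK_mem_A'' : C.tK ∈ C.A'' H.hj := by
  rw [← C.t_eq_tK H.hj]; exact C.A''₀_le_A'' H.hj (C.t_mem_A''₀ H.hj)

/-- The element `t ∈ A″_j`. [folklore] -/
def tS : C.A'' H.hj := ⟨C.tK, tK_mem_A'' C ε H⟩

/-- `t ≠ 0` in `A″_j`. [folklore] -/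
theorem tS_ne_zero : tS C ε H ≠ 0 := fun h0 => by
  have := congrArg Subtype.val h0
  change C.tK = 0 at this
  rw [← C.t_eq_tK H.hj] at this
  exact C.t_ne_zero H.hj this

include hjW in
/-- `μ(t_E) = t`. [folklore] -/
theorem μ_tEu : μ C ε H hBw hjW (C.tEu ε H : C.E₀ ε) = algebraMap (C.A'' H.hj) (D₂ C ε H hBw) (tS C ε H) :=
  μ_zE C ε H hBw hjW (tK_mem_A'' C ε H) C.tK_mem_Rh _ (ε.hUr _ H.htU)

include hjW in
/-- `μ(y_E) = y`. [folklore] -/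
theorem μ_yE : μ C ε H hBw hjW (C.yE ε) = algebraMap (C.A'' H.hj) (D₂ C ε H hBw) (C.yS H.hj) :=
  μ_zE C ε H hBw hjW (C.A₀_subset_A'' H.hj C.y_mem_A₀) (C.A₀_subset_Rh C.y_mem_A₀) _ H.hyr

include hjW in
/-- `μ(r_{a,E}) = r_a`. [folklore] -/
theorem μ_raE : μ C ε H hBw hjW (C.raE ε) =
    algebraMap (C.A'' H.hj) (D₂ C ε H hBw) ⟨C.ra, C.A₀_subset_A'' H.hj C.ra_mem_A₀⟩ :=
  μ_zE C ε H hBw hjW (C.A₀_subset_A'' H.hj C.ra_mem_A₀) (C.A₀_subset_Rh C.ra_mem_A₀) _ H.hrar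

include hjW in
/-- `μ(y₀) = ζ` (the constant `y₀ ∈ m°` goes to the Hensel root). [folklore] -/
theorem μ_y₀O : μ C ε H hBw hjW (algebraMap O (C.E₀ ε) (C.y₀O)) =
    algebraMap (C.D₀ e H.hj H.hje) (D₂ C ε H hBw) (C.ζ e H.hj H.hje) := by
  rw [μ_algebraMap_O, μO₂, RingHom.comp_apply,
    show C.y₀O = ⟨C.y₀, C.mem_O_of_isIntegral C.y₀_isIntegral⟩ from rfl,
    μO_of_isIntegral C e H.hj H.hje C.y₀_isIntegral, C.θ₀_y₀, ← IsScalarTower.algebraMap_apply]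

/-- The `D`-side identity `π^{e+N_a} Z · t = (ζ − y) r_a` in `D₀`. [folklore] -/
theorem D_side_identity :
    algebraMap (C.A'' H.hj) (C.D₀ e H.hj H.hje) (C.πS H.hj ^ (e + C.Na)) * C.Z e H.hj H.hje *
      algebraMap (C.A'' H.hj) (C.D₀ e H.hj H.hje) (tS C ε H) =
    (C.ζ e H.hj H.hje - algebraMap (C.A'' H.hj) (C.D₀ e H.hj H.hje) (C.yS H.hj)) *
      algebraMap (C.A'' H.hj) (C.D₀ e H.hj H.hje) ⟨C.ra, C.A₀_subset_A'' H.hj C.ra_mem_A₀⟩ := by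
  have hζ : C.ζ e H.hj H.hje - algebraMap (C.A'' H.hj) (C.D₀ e H.hj H.hje) (C.yS H.hj) =
      algebraMap (C.A'' H.hj) (C.D₀ e H.hj H.hje) (C.δS e H.hj) * C.Z e H.hj H.hje := by
    rw [ζ]; ring
  have hδ : C.δS e H.hj = C.πS H.hj ^ e * ⟨C.ay, C.A₀_subset_A'' H.hj C.ay_mem_A₀⟩ := Subtype.ext rfl
  have hat : (⟨C.ay, C.A₀_subset_A'' H.hj C.ay_mem_A₀⟩ : C.A'' H.hj) *
      ⟨C.ra, C.A₀_subset_A'' H.hj C.ra_mem_A₀⟩ = C.πS H.hj ^ C.Na * tS C ε H := by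
    apply Subtype.ext
    change C.ay * C.ra = C.πK ^ C.Na * C.tK
    rw [C.ay_mul_ra H.hj, C.t_eq_tK H.hj]
  rw [hζ, hδ, pow_add]
  have h2 := congrArg (algebraMap (C.A'' H.hj) (C.D₀ e H.hj H.hje)) hat
  rw [map_mul, map_mul, map_pow] at h2
  simp only [map_mul, map_pow]
  linear_combination (-(algebraMap (C.A'' H.hj) (C.D₀ e H.hj H.hje)) (C.πS H.hj) ^ e * C.Z e H.hj H.hje) * h2

include hjW in
/-- **(P2) `μ(Z_E) = Z`.** [folklore] -/
theorem μ_ZE : μ C ε H hBw hjW (C.ZE ε H) =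
    algebraMap (C.D₀ e H.hj H.hje) (D₂ C ε H hBw) (C.Z e H.hj H.hje) := by
  -- the `E`-side identity `π^{e+N_a} Z_E · t_E = (y₀ − y_E) r_{a,E}`
  have hE : algebraMap O (C.E₀ ε) (C.πO ^ (e + C.Na)) * C.ZE ε H * (C.tEu ε H : C.E₀ ε) =
      (algebraMap O (C.E₀ ε) (C.y₀O) - C.yE ε) * C.raE ε := by
    rw [C.ZE_spec ε H, ιlE, mul_assoc, mul_assoc, Units.inv_mul, mul_one]
  have hμ := congrArg (μ C ε H hBw hjW) hE
  rw [map_mul, map_mul, map_mul, map_sub, μ_tEu, μ_yE, μ_raE, μ_y₀O, μ_algebraMap_O, μO₂,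
    RingHom.comp_apply, map_pow, μO_πO, ← map_pow, ← IsScalarTower.algebraMap_apply] at hμ
  -- the `D`-side identity, mapped to `D₂`
  have hD := congrArg (algebraMap (C.D₀ e H.hj H.hje) (D₂ C ε H hBw)) (D_side_identity C ε H)
  rw [map_mul, map_mul, map_mul, map_sub, ← IsScalarTower.algebraMap_apply,
    ← IsScalarTower.algebraMap_apply, ← IsScalarTower.algebraMap_apply,
    ← IsScalarTower.algebraMap_apply] at hD
  rw [← hD] at hμ
  -- cancel `t` and `π^{e+N_a}`
  have h3 : algebraMap (C.A'' H.hj) (D₂ C ε H hBw) (tS C ε H) *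
      (algebraMap (C.A'' H.hj) (D₂ C ε H hBw) (C.πS H.hj ^ (e + C.Na)) * μ C ε H hBw hjW (C.ZE ε H)) =
      algebraMap (C.A'' H.hj) (D₂ C ε H hBw) (tS C ε H) *
      (algebraMap (C.A'' H.hj) (D₂ C ε H hBw) (C.πS H.hj ^ (e + C.Na)) *
        algebraMap (C.D₀ e H.hj H.hje) (D₂ C ε H hBw) (C.Z e H.hj H.hje)) := by
    linear_combination hμ
  exact π_cancel C H.hj (D₂ C ε H hBw) (mul_left_cancel_A'' C H.hj (D₂ C ε H hBw) (tS_ne_zero C ε H) h3)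

/-! ### `μ₁ : E₁ → D₂` and (α) `μ₁ ∘ Λ₀ = D₀ → D₂` -/

include hjW in
/-- `μ` of an `A″_j`-polynomial over `λ₀` evaluated at `Z_E`: the same polynomial at `Z` in `D₂`.
[folklore] -/
theorem μ_aeval_ZE (q : (C.A'' H.hj)[X]) :
    μ C ε H hBw hjW (Polynomial.aeval (C.ZE ε H) (q.map (C.lam₀ ε H))) =
      algebraMap (C.D₀ e H.hj H.hje) (D₂ C ε H hBw) (Polynomial.aeval (C.Z e H.hj H.hje) q) := by
  rw [Polynomial.aeval_def, Polynomial.eval₂_map, Algebra.algebraMap_self, RingHom.id_comp,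
    show μ C ε H hBw hjW (Polynomial.eval₂ (C.lam₀ ε H) (C.ZE ε H) q) =
      (μ C ε H hBw hjW : C.E₀ ε →+* D₂ C ε H hBw) (Polynomial.eval₂ (C.lam₀ ε H) (C.ZE ε H) q) from rfl,
    Polynomial.hom_eval₂, μ_comp_lam₀ C ε H hBw hjW,
    show (μ C ε H hBw hjW : C.E₀ ε →+* D₂ C ε H hBw) (C.ZE ε H) = μ C ε H hBw hjW (C.ZE ε H) from rfl,
    μ_ZE C ε H hBw hjW, IsScalarTower.algebraMap_eq (C.A'' H.hj) (C.D₀ e H.hj H.hje) (D₂ C ε H hBw),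
    ← Polynomial.hom_eval₂, ← Polynomial.aeval_def]

include hjW in
/-- **`μ(g_{D,λ})` is a unit** (it is `g_D(Z)`, inverted in `D₀`). [folklore] -/
theorem isUnit_μ_gDlam : IsUnit (μ C ε H hBw hjW (C.gDlam ε H)) := by
  rw [gDlam, μ_aeval_ZE]
  exact ((C.PD e H.hj H.hje).hasMap_X.2).map _

/-- **`μ₁ : E₁ → D₂`** — the extension of `μ` to `E₁ = E₀[1/g_{D,λ}]`. [folklore] -/
def μ₁ : C.E₁ ε H →+* D₂ C ε H hBw :=
  IsLocalization.Away.lift (C.gDlam ε H) (g := (μ C ε H hBw hjW : C.E₀ ε →+* D₂ C ε H hBw))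
    (isUnit_μ_gDlam C ε H hBw hjW)

/-- `μ₁` extends `μ`. [folklore] -/
@[simp] theorem μ₁_algebraMap (x : C.E₀ ε) :
    μ₁ C ε H hBw hjW (algebraMap (C.E₀ ε) (C.E₁ ε H) x) = μ C ε H hBw hjW x :=
  IsLocalization.Away.lift_eq _ _ x

/-- `μ₁` on `A″_j`: the structure map (P1). [folklore] -/
theorem μ₁_algebraMap_A'' (a : C.A'' H.hj) :
    μ₁ C ε H hBw hjW (algebraMap (C.A'' H.hj) (C.E₁ ε H) a) = algebraMap (C.A'' H.hj) (D₂ C ε H hBw) a := by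
  rw [C.algebraMap_AE₁ ε H, RingHom.comp_apply, μ₁_algebraMap, μ_lam₀]

/-- `μ₁` as an `A″_j`-algebra map. [folklore] -/
def μ₁A : C.E₁ ε H →ₐ[C.A'' H.hj] D₂ C ε H hBw :=
  { toRingHom := μ₁ C ε H hBw hjW
    commutes' := fun a => μ₁_algebraMap_A'' C ε H hBw hjW a }

/-- `μ₁A = μ₁` as functions. [folklore] -/
@[simp] theorem μ₁A_apply (x : C.E₁ ε H) : μ₁A C ε H hBw hjW x = μ₁ C ε H hBw hjW x := rfl

/-- **(α) `μ₁ ∘ Λ₀ = D₀ → D₂`.** [folklore] -/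
theorem μ₁A_comp_Λ₀ : (μ₁A C ε H hBw hjW).comp (C.Λ₀ ε H) =
    IsScalarTower.toAlgHom (C.A'' H.hj) (C.D₀ e H.hj H.hje) (D₂ C ε H hBw) := by
  refine EtalePair.hom_ext ?_
  rw [AlgHom.comp_apply, IsScalarTower.coe_toAlgHom', μ₁A_apply,
    show (C.PD e H.hj H.hje).X = C.Z e H.hj H.hje from rfl, C.Λ₀_Z, ZE₁, μ₁_algebraMap, μ_ZE]

/-- `μ₁(Λ₀ x) = x`. [folklore] -/
@[simp] theorem μ₁_Λ₀ (x : C.D₀ e H.hj H.hje) :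
    μ₁ C ε H hBw hjW (C.Λ₀ ε H x) = algebraMap (C.D₀ e H.hj H.hje) (D₂ C ε H hBw) x := by
  have := congrArg (fun f => f x) (μ₁A_comp_Λ₀ C ε H hBw hjW)
  simpa using this

/-- The point is respected: `σ₂ ∘ μ₁ = σ_{E,1}`. [folklore] -/
theorem σ₂_comp_μ₁ : (σ₂ C ε H hBw).comp (μ₁ C ε H hBw hjW) = C.σE₁ ε H := by
  refine IsLocalization.ringHom_ext (Submonoid.powers (C.gDlam ε H)) ?_
  ext x
  simp only [RingHom.coe_comp, Function.comp_apply, μ₁_algebraMap, σ₂_μ, σE₁_algebraMap]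

end StepXIV

/-! ## XV. `Λ : D₂ → E₁` and the isomorphism `E₁ ≅ D₂` -/

section StepXV

variable (ε : C.EParams)

/-! ### Ambient rings `Ω_T = T ⊗_{m°} m` over the polydisc chart -/

section AmbE

variable (T : Type u) [CommRing T] [Algebra O T] [Algebra (C.E₀ ε) T] [IsScalarTower O (C.E₀ ε) T]

/-- `Ω_T = T ⊗_{m°} m`. [folklore] -/
abbrev ΩT : Type u := TensorProduct O T m

/-- `ι_T : T → Ω_T`. [folklore] -/
abbrev ιT : T →ₐ[O] ΩT (O := O) T := Algebra.TensorProduct.includeLeft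

/-- `ι_{m,T} : m → Ω_T`. [folklore] -/
abbrev ιmT : m →ₐ[O] ΩT (O := O) T := Algebra.TensorProduct.includeRight

omit [Algebra (C.E₀ ε) T] [IsScalarTower O (C.E₀ ε) T] in
/-- `ι_T` is injective for `T` flat over the domain `m°`. [folklore] -/
theorem ιT_injective [Module.Flat O T] : Function.Injective (ιT (O := O) T) :=
  Algebra.TensorProduct.includeLeft_injective (S := O) Subtype.val_injective

omit [Algebra (C.E₀ ε) T] [IsScalarTower O (C.E₀ ε) T] in
/-- `ι_{m,T}(a) = ι_T(a)` for `a ∈ m°`. [folklore] -/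
theorem ιmT_coe (a : O) : ιmT (O := O) T (a : m) = ιT (O := O) T (algebraMap O T a) := by
  rw [show (a : m) = algebraMap O m a from rfl, AlgHom.commutes, AlgHom.commutes]

omit [Algebra (C.E₀ ε) T] [IsScalarTower O (C.E₀ ε) T] in
/-- Nonzero elements of `m` are units of `Ω_T`. [folklore] -/
theorem isUnit_ιmT {a : m} (ha : a ≠ 0) : IsUnit (ιmT (O := O) T a) := (IsUnit.mk0 a ha).map _

/-- The transition `Ω_E → Ω_T`. [folklore] -/
def ΩEto : C.ΩE ε →ₐ[O] ΩT (O := O) T :=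
  Algebra.TensorProduct.map (IsScalarTower.toAlgHom O (C.E₀ ε) T) (AlgHom.id O m)

/-- `Ω_E → Ω_T` on `ι_E`. [folklore] -/
@[simp] theorem ΩEto_ιE (x : C.E₀ ε) : ΩEto C ε T (C.ιE ε x) = ιT (O := O) T (algebraMap (C.E₀ ε) T x) := by
  change ΩEto C ε T (x ⊗ₜ 1) = (algebraMap _ _ x) ⊗ₜ 1
  rw [ΩEto, Algebra.TensorProduct.map_tmul]; rfl

/-- `Ω_E → Ω_T` on `ι_m`. [folklore] -/
@[simp] theorem ΩEto_ιm (a : m) : ΩEto C ε T (C.ιm ε a) = ιmT (O := O) T a := by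
  change ΩEto C ε T (1 ⊗ₜ a) = 1 ⊗ₜ a
  rw [ΩEto, Algebra.TensorProduct.map_tmul, map_one]; rfl

end AmbE

variable {e j : ℕ} (H : C.EHyps ε e j)

/-! ### (P3) `Λ₀ ∘ θN` is the structure map `N → m° → E₁` -/

/-- `λ₀` on `k°` as an identity of ring homomorphisms. [folklore] -/
theorem lam₀_comp_baseToA'' : (C.lam₀ ε H).comp (C.baseToA'' H.hj) = (algebraMap O (C.E₀ ε)).comp C.vO :=
  RingHom.ext fun v => lam₀_baseToA'' C ε H v

/-- `Λ₀(ζ) = ζ_E`. [folklore] -/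
theorem Λ₀_ζ : C.Λ₀ ε H (C.ζ e H.hj H.hje) = algebraMap (C.E₀ ε) (C.E₁ ε H) (C.ζE ε H) := by
  rw [ζ, map_add, map_mul, C.Λ₀_algebraMap, C.Λ₀_algebraMap, C.lam₀_yS, C.lam₀_δS, C.Λ₀_Z, ZE₁, ζE]
  simp only [map_add, map_mul, map_pow]

/-- Evaluating a `k°`-polynomial at `λ₀`-images: `Λ₀(Θ(x)) = Θ(x_E)` in `E₁` for `Λ₀ x = x_E`
(`eval₂` form). [folklore] -/
theorem Λ₀_eval₂_base (Θ : V[X]) (x : C.D₀ e H.hj H.hje) (xE : C.E₀ ε)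
    (hx : C.Λ₀ ε H x = algebraMap (C.E₀ ε) (C.E₁ ε H) xE) :
    C.Λ₀ ε H (Θ.eval₂ ((algebraMap (C.A'' H.hj) (C.D₀ e H.hj H.hje)).comp (C.baseToA'' H.hj)) x) =
      algebraMap (C.E₀ ε) (C.E₁ ε H) (Θ.eval₂ ((algebraMap O (C.E₀ ε)).comp C.vO) xE) := by
  rw [show C.Λ₀ ε H (Polynomial.eval₂ _ x Θ) = (C.Λ₀ ε H : C.D₀ e H.hj H.hje →+* C.E₁ ε H) (Polynomial.eval₂ _ x Θ)
      from rfl, Polynomial.hom_eval₂, ← RingHom.comp_assoc,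
    show (C.Λ₀ ε H : C.D₀ e H.hj H.hje →+* C.E₁ ε H).comp (algebraMap (C.A'' H.hj) (C.D₀ e H.hj H.hje)) =
      algebraMap (C.A'' H.hj) (C.E₁ ε H) from RingHom.ext fun a => (C.Λ₀ ε H).commutes a,
    C.algebraMap_AE₁ ε H, RingHom.comp_assoc, lam₀_comp_baseToA'',
    show (C.Λ₀ ε H : C.D₀ e H.hj H.hje →+* C.E₁ ε H) x = C.Λ₀ ε H x from rfl, hx, ← Polynomial.hom_eval₂]

/-- The same, `aeval` form. [folklore] -/
theorem Λ₀_aeval_base (Θ : V[X]) (x : C.D₀ e H.hj H.hje) (xE : C.E₀ ε)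
    (hx : C.Λ₀ ε H x = algebraMap (C.E₀ ε) (C.E₁ ε H) xE) :
    C.Λ₀ ε H (Polynomial.aeval x (Θ.map ((algebraMap (C.A'' H.hj) (C.D₀ e H.hj H.hje)).comp (C.baseToA'' H.hj)))) =
      algebraMap (C.E₀ ε) (C.E₁ ε H) (Θ.eval₂ ((algebraMap O (C.E₀ ε)).comp C.vO) xE) := by
  rw [Polynomial.aeval_def, Polynomial.eval₂_map, Algebra.algebraMap_self, RingHom.id_comp,
    Λ₀_eval₂_base C ε H Θ x xE hx]

/-- The same, `eval` form. [folklore] -/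
theorem Λ₀_eval_base (Θ : V[X]) (x : C.D₀ e H.hj H.hje) (xE : C.E₀ ε)
    (hx : C.Λ₀ ε H x = algebraMap (C.E₀ ε) (C.E₁ ε H) xE) :
    C.Λ₀ ε H ((Θ.map ((algebraMap (C.A'' H.hj) (C.D₀ e H.hj H.hje)).comp (C.baseToA'' H.hj))).eval x) =
      algebraMap (C.E₀ ε) (C.E₁ ε H) (Θ.eval₂ ((algebraMap O (C.E₀ ε)).comp C.vO) xE) := by
  rw [Polynomial.eval_map, Λ₀_eval₂_base C ε H Θ x xE hx]

/-- `ι_E` of a `k°`-polynomial evaluated in `E₀`: the same polynomial over `m` in `Ω_E`. [folklore] -/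
theorem ιE_eval₂_base (Θ : V[X]) (xE : C.E₀ ε) :
    C.ιE ε (Θ.eval₂ ((algebraMap O (C.E₀ ε)).comp C.vO) xE) =
      Θ.eval₂ ((C.ιm ε : m →+* C.ΩE ε).comp ((algebraMap k m).comp (algebraMap V k))) (C.ιE ε xE) := by
  rw [show C.ιE ε (Θ.eval₂ _ xE) = (C.ιE ε : C.E₀ ε →+* C.ΩE ε) (Θ.eval₂ _ xE) from rfl, Polynomial.hom_eval₂]
  congr 1
  ext v
  simp only [RingHom.coe_comp, Function.comp_apply]
  change C.ιE ε (algebraMap O (C.E₀ ε) (C.vO v)) = C.ιm ε (algebraMap k m (v : k))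
  rw [← C.ιm_coe ε]
  rfl

/-- `ψ_E` of a `k`-polynomial evaluated in `Rh`. [folklore] -/
theorem ψE_aeval_k (z : C.Rh) (q : k[X]) :
    C.ψE ε (Polynomial.aeval z q) = q.eval₂ ((C.ιm ε : m →+* C.ΩE ε).comp (algebraMap k m)) (C.ψE ε z) := by
  rw [Polynomial.aeval_def, show C.ψE ε (Polynomial.eval₂ _ z q) = (C.ψE ε : C.Rh →+* C.ΩE ε) (Polynomial.eval₂ _ z q)
    from rfl, Polynomial.hom_eval₂]
  congr 1
  ext c
  simp only [RingHom.coe_comp, Function.comp_apply]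
  exact C.ψE_algebraMap_k ε c

/-- A polynomial over `m` evaluated at `ι_m(y₀)`. [folklore] -/
theorem eval₂_ιm_y₀ (Θ : V[X]) :
    Θ.eval₂ ((C.ιm ε : m →+* C.ΩE ε).comp ((algebraMap k m).comp (algebraMap V k))) (C.ιm ε C.y₀) =
      C.ιm ε (Polynomial.aeval C.y₀ (Θ.map (algebraMap V k))) := by
  rw [Polynomial.aeval_def, Polynomial.eval₂_map,
    show C.ιm ε (Polynomial.eval₂ _ C.y₀ Θ) = (C.ιm ε : m →+* C.ΩE ε) (Polynomial.eval₂ _ C.y₀ Θ) from rfl,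
    Polynomial.hom_eval₂]
  rfl

/-- **(P3) `Λ₀(θN ν) = ν`** for `ν ∈ N`. [folklore] -/
theorem Λ₀_θN (ν : intN (m := m) V) :
    C.Λ₀ ε H (θN C e H.hj H.hje ν) = algebraMap O (C.E₁ ε H) (NtoO C ν) := by
  obtain ⟨Θ, d, hΘ⟩ := C.exists_poly (ν : m)
  have h1 := congrArg (C.Λ₀ ε H) (pow_mul_θN_eq_aeval C e H.hj H.hje ν Θ d hΘ)
  rw [map_mul, C.Λ₀_algebraMap, map_pow, C.lam₀_πS,
    Λ₀_aeval_base C ε H Θ _ _ (Λ₀_ζ C ε H)] at h1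
  -- push into `Ω_{E₁}`
  apply ιT_injective (O := O) (C.E₁ ε H)
  have h2 := congrArg (ιT (O := O) (C.E₁ ε H)) h1
  rw [map_mul, ← ΩEto_ιE C ε, ← ΩEto_ιE C ε, ιE_eval₂_base, C.ιE_ζE ε H, eval₂_ιm_y₀, hΘ, map_pow,
    ← C.ιm_coe ε, coe_πO] at h2
  simp only [map_mul, map_pow, ΩEto_ιm] at h2
  rw [← ιmT_coe, coe_NtoO]
  exact ((isUnit_ιmT (O := O) (C.E₁ ε H) C.π_ne_zero_m).pow d).mul_left_cancel h2

/-- `Λ₀(θ₀ ν) = ν` for an integral `ν`, membership form. [folklore] -/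
theorem Λ₀_θ₀ {ν : m} (hν : IsIntegral (baseRing m V) ν) :
    C.Λ₀ ε H (C.θ₀ e H.hj H.hje hν) = algebraMap O (C.E₁ ε H) ⟨ν, C.mem_O_of_isIntegral hν⟩ :=
  Λ₀_θN C ε H ⟨ν, mem_intN_iff.mpr hν⟩

/-! ### `Λ₁ : D₁ → E₁` and `Λ₁ ∘ μB` -/

/-- `Λ₀(θN f)` is a unit (it is the unit `f` of `m°`). [folklore] -/
theorem isUnit_Λ₀_θf : IsUnit (C.Λ₀ ε H (θf C e H.hj H.hje)) := by
  rw [θf, Λ₀_θN]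
  refine (isUnit_iff_exists_inv.mpr ⟨⟨C.fO⁻¹, C.fO_inv_mem⟩, Subtype.ext ?_⟩).map _
  change C.fO * C.fO⁻¹ = 1
  exact mul_inv_cancel₀ C.fO_ne_zero

/-- **`Λ₁ : D₁ → E₁`** — the extension of `Λ₀` to `D₁ = D₀[1/θN f]`. [folklore] -/
def Λ₁ : D₁ C e H.hj H.hje →+* C.E₁ ε H :=
  IsLocalization.Away.lift (θf C e H.hj H.hje) (g := (C.Λ₀ ε H : C.D₀ e H.hj H.hje →+* C.E₁ ε H))
    (isUnit_Λ₀_θf C ε H)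

/-- `Λ₁` extends `Λ₀`. [folklore] -/
@[simp] theorem Λ₁_algebraMap (x : C.D₀ e H.hj H.hje) :
    Λ₁ C ε H (algebraMap (C.D₀ e H.hj H.hje) (D₁ C e H.hj H.hje) x) = C.Λ₀ ε H x :=
  IsLocalization.Away.lift_eq _ _ x

/-- `Λ₁` on `A″_j`. [folklore] -/
theorem Λ₁_algebraMap_A'' (a : C.A'' H.hj) :
    Λ₁ C ε H (algebraMap (C.A'' H.hj) (D₁ C e H.hj H.hje) a) = algebraMap (C.E₀ ε) (C.E₁ ε H) (C.lam₀ ε H a) := by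
  rw [IsScalarTower.algebraMap_apply (C.A'' H.hj) (C.D₀ e H.hj H.hje) (D₁ C e H.hj H.hje), Λ₁_algebraMap,
    C.Λ₀_algebraMap]

/-- **`Λ₁ ∘ μO = m° → E₁`.** [folklore] -/
theorem Λ₁_μO (a : O) : Λ₁ C ε H (μO C e H.hj H.hje a) = algebraMap O (C.E₁ ε H) a := by
  have key : (Λ₁ C ε H).comp (μO C e H.hj H.hje) = algebraMap O (C.E₁ ε H) := by
    refine ringHom_ext_O C fun ν => ?_
    rw [RingHom.comp_apply, μO_NtoO, Λ₁_algebraMap, Λ₀_θN]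
  exact congrArg (fun f => f a) key

/-- `h⁻¹ ∈ Rh`. [folklore] -/
theorem h_inv_mem_Rh : C.h⁻¹ ∈ C.Rh :=
  (C.mem_Rh_iff _).mpr ⟨1, by rw [pow_one, mul_inv_cancel₀ C.hh0]; exact Subalgebra.one_mem _⟩

/-- `u′_{D,i} ∈ Rh`. [folklore] -/
theorem uD_mem_Rh (i : Fin C.n) : (C.uD H.hj i : K) ∈ C.Rh :=
  C.Rh.mul_mem (C.R_le_Rh (C.u_mem_R j i)) (C.Rh.pow_mem (h_inv_mem_Rh C) _)

/-- `ψ_E(u′_{D,i}) = ι_E(u′ᵢ)`: the polydisc coordinates match. [folklore] -/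
theorem ψE_uD (i : Fin C.n) : C.ψE ε ⟨(C.uD H.hj i : K), uD_mem_Rh C ε H i⟩ = C.ιE ε (C.uE ε i) := by
  have key : algebraMap k C.Rh (C.π ^ ε.jz) * ⟨(C.uD H.hj i : K), uD_mem_Rh C ε H i⟩ = C.Tsub i := by
    apply Subtype.ext
    change algebraMap k K (C.π ^ ε.jz) * (C.uD H.hj i : K) = C.T i
    rw [map_pow, ← πK, C.πK_pow_mul_uD H.hj ε.jz H.hjc i]
  have h1 := congrArg (C.ψE ε) key
  rw [map_mul, ψE_algebraMap_k, map_pow, C.ψE_Tsub, map_mul, map_mul, ← C.ιm_coe' ε,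
    SubmonoidClass.coe_pow, coe_πO, map_pow] at h1
  exact ((C.isUnit_ιm ε C.π_ne_zero_m).pow _).mul_left_cancel h1

/-- **`λ₀(u′_{D,i}) = u′ᵢ`.** [folklore] -/
theorem lam₀_uD (i : Fin C.n) : C.lam₀ ε H (C.uD H.hj i) = C.uE ε i :=
  C.ιE_injective ε (by rw [C.ιE_lam₀ ε H (C.uD H.hj i).2 (uD_mem_Rh C ε H i)]; exact ψE_uD C ε H i)

/-- **`Λ₁ ∘ μB = m°[X] → E₁`.** [folklore] -/
theorem Λ₁_comp_μB : (Λ₁ C ε H).comp (μB C ε H) = algebraMap (MvPolynomial (Fin C.n) O) (C.E₁ ε H) := by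
  refine MvPolynomial.ringHom_ext (fun a => ?_) (fun i => ?_)
  · rw [RingHom.comp_apply, μB_C, Λ₁_μO, ← MvPolynomial.algebraMap_eq,
      ← IsScalarTower.algebraMap_apply]
  · rw [RingHom.comp_apply, μB_X, Λ₁_algebraMap_A'', lam₀_uD, uE, ← IsScalarTower.algebraMap_apply]

/-! ### (P4) `Λ₁(W_D) = W` -/

variable (hBw : C.Bw ≤ j) (hjW : C.Bw + (C.N₀ + ε.r + C.dΘ) ≤ j)

include hBw in
/-- `g_w ∈ A″_j` (it is `π^{j−b_w} γ_w`). [folklore] -/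
theorem gw_mem_A'' : C.gw ∈ C.A'' H.hj := by
  rw [C.gw_eq H.hj (le_trans C.bw_le_Bw hBw)]
  exact (C.πS H.hj ^ (j - C.bw) * C.γwS H.hj (le_trans C.bw_le_Bw hBw)).2

/-- `Λ₀` of the `γ_w`-term: `λ₀(g_w)`. [folklore] -/
theorem Λ₀_γw_term : C.Λ₀ ε H (algebraMap (C.A'' H.hj) (C.D₀ e H.hj H.hje)
      (C.πS H.hj ^ (j - C.bw) * C.γwS H.hj (le_trans C.bw_le_Bw hBw))) =
    algebraMap (C.E₀ ε) (C.E₁ ε H) (C.lam₀ ε H ⟨C.gw, gw_mem_A'' C ε H hBw⟩) := by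
  rw [C.Λ₀_algebraMap]
  congr 2
  apply Subtype.ext
  change C.πK ^ (j - C.bw) * C.γw H.hj (le_trans C.bw_le_Bw hBw) = C.gw
  rw [← C.gw_eq H.hj (le_trans C.bw_le_Bw hBw)]

/-- `ψ_E(g_w) = π^{d_Θ} w′_E − Θ_w(ψ_E y)` in `Ω_E`. [folklore] -/
theorem ψE_gw : C.ψE ε ⟨C.gw, C.gw_mem_Rh⟩ =
    C.ιm ε (algebraMap k m C.π) ^ C.dΘ * C.w'E ε -
      C.Θw.eval₂ ((C.ιm ε : m →+* C.ΩE ε).comp ((algebraMap k m).comp (algebraMap V k))) (C.ψE ε C.yR) := by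
  have hgw : (⟨C.gw, C.gw_mem_Rh⟩ : C.Rh) = algebraMap k C.Rh (C.π ^ C.dΘ) * C.w' -
      Polynomial.aeval C.yR (C.Θw.map (algebraMap V k)) := by
    apply Subtype.ext
    change C.gw = algebraMap k K (C.π ^ C.dΘ) * (C.w' : K) - ((Polynomial.aeval C.yR (C.Θw.map (algebraMap V k)) : C.Rh) : K)
    rw [gw, map_pow, ← πK, show ((Polynomial.aeval C.yR (C.Θw.map (algebraMap V k)) : C.Rh) : K) =
      Polynomial.aeval C.y (C.Θw.map (algebraMap V k)) from by
        change C.Rh.val (Polynomial.aeval C.yR _) = _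
        rw [← Polynomial.aeval_algHom_apply]; rfl]
  rw [hgw, map_sub, map_mul, ψE_algebraMap_k, map_pow, map_pow, C.ψE_w', ψE_aeval_k, Polynomial.eval₂_map,
    RingHom.comp_assoc]

/-- `ι_E(w′_E) = w₀′ + c₀′π^r W` in `Ω_E`. [folklore] -/
theorem w'E_eq : C.w'E ε = C.ιm ε C.w₀' + C.ιm ε ((C.c₀' : m) * algebraMap k m C.π ^ ε.r) * C.ιE ε (C.W ε) := by
  rw [w'E, WE, lin, map_add, map_mul, Polynomial.aeval_C, Polynomial.aeval_C, Polynomial.aeval_X, map_add,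
    map_mul, ← C.ιm_coe' ε, ← C.ιm_coe' ε, Subring.coe_mul, SubmonoidClass.coe_pow, coe_πO]
  rfl

include hjW in
/-- **(P4) `Λ₀(W_D) = W`.** [folklore] -/
theorem Λ₀_WD : C.Λ₀ ε H (C.WD e H.hj H.hje hBw ε.r) = algebraMap (C.E₀ ε) (C.E₁ ε H) (C.W ε) := by
  have h1 := congrArg (C.Λ₀ ε H) (C.WD_spec e H.hj H.hje hBw ε.r hjW)
  rw [map_mul, map_mul, map_pow, C.Λ₀_algebraMap, C.lam₀_πS, Λ₀_θ₀, Δw, map_add, map_sub,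
    Λ₀_γw_term C ε H hBw, ΘwD,
    Λ₀_eval_base C ε H C.Θw _ _ (by rw [C.Λ₀_algebraMap, C.lam₀_yS]),
    Λ₀_eval_base C ε H C.Θw _ _ (Λ₀_ζ C ε H)] at h1
  -- push into `Ω_{E₁}`
  rw [← IsScalarTower.algebraMap_apply O (C.E₀ ε) (C.E₁ ε H)] at h1
  apply ιT_injective (O := O) (C.E₁ ε H)
  have h2 := congrArg (ιT (O := O) (C.E₁ ε H)) h1
  simp only [map_mul, map_add, map_sub, map_pow] at h2
  rw [← ιmT_coe, ← ιmT_coe, coe_πO,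
    ← ΩEto_ιE C ε (C.E₁ ε H) (C.lam₀ ε H _),
    ← ΩEto_ιE C ε (C.E₁ ε H) (Polynomial.eval₂ _ (C.yE ε) _),
    ← ΩEto_ιE C ε (C.E₁ ε H) (Polynomial.eval₂ _ (C.ζE ε H) _),
    C.ιE_lam₀ ε H (gw_mem_A'' C ε H hBw) C.gw_mem_Rh, ψE_gw, ιE_eval₂_base, ιE_eval₂_base, C.ιE_ζE ε H,
    eval₂_ιm_y₀, C.aeval_y₀_Θw, yE, C.ιE_zE ε _ _ H.hyr, w'E_eq] at h2
  simp only [map_mul, map_add, map_sub, map_pow, ΩEto_ιm, ΩEto_ιE] at h2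
  have hι : ιmT (O := O) (C.E₁ ε H) (C.c₀' : m) * ιmT (O := O) (C.E₁ ε H) C.ι₀ =
      ιmT (O := O) (C.E₁ ε H) (algebraMap k m C.π) ^ C.N₀ := by
    rw [← map_mul, C.c₀'_mul_ι₀, map_pow]
  set p := ιmT (O := O) (C.E₁ ε H) (algebraMap k m C.π) with hp
  set Wt := ιT (O := O) (C.E₁ ε H) (algebraMap (C.E₀ ε) (C.E₁ ε H) (C.W ε)) with hWt
  set X := ιT (O := O) (C.E₁ ε H) (C.Λ₀ ε H (C.WD e H.hj H.hje hBw ε.r)) with hX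
  have key : p ^ (C.N₀ + ε.r + C.dΘ) * X = p ^ (C.N₀ + ε.r + C.dΘ) * Wt := by
    rw [h2]
    linear_combination p ^ C.dΘ * p ^ ε.r * Wt * hι
  exact ((isUnit_ιmT (O := O) (C.E₁ ε H) C.π_ne_zero_m).pow _).mul_left_cancel key

include hjW in
/-- **(P4) `Λ₁(W_D) = W`.** [folklore] -/
theorem Λ₁_WD₁ : Λ₁ C ε H (WD₁ C ε H hBw) = algebraMap (C.E₀ ε) (C.E₁ ε H) (C.W ε) := by
  rw [WD₁, Λ₁_algebraMap, Λ₀_WD C ε H hBw hjW]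

/-! ### `Λ₂ : D₂ → E₁`, (β) `Λ₂ ∘ μ = E₀ → E₁`, and the isomorphism -/

include hjW in
/-- `Λ₁` of a `m°[X]`-polynomial at `W_D`: the same polynomial at `W` in `E₁`. [folklore] -/
theorem Λ₁_eval₂ (Ψ : (MvPolynomial (Fin C.n) O)[X]) :
    Λ₁ C ε H (Ψ.eval₂ (μB C ε H) (WD₁ C ε H hBw)) =
      algebraMap (C.E₀ ε) (C.E₁ ε H) (Polynomial.aeval (C.W ε) Ψ) := by
  rw [Polynomial.hom_eval₂, Λ₁_comp_μB, Λ₁_WD₁ C ε H hBw hjW, Polynomial.aeval_def,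
    IsScalarTower.algebraMap_eq (MvPolynomial (Fin C.n) O) (C.E₀ ε) (C.E₁ ε H), ← Polynomial.hom_eval₂]

include hjW in
/-- `Λ₁(gEW)` is a unit (it is `g_E(W)`, inverted in `E₀`). [folklore] -/
theorem isUnit_Λ₁_gEW : IsUnit (Λ₁ C ε H (gEW C ε H hBw)) := by
  rw [gEW, Λ₁_eval₂ C ε H hBw hjW]
  exact ((C.PE ε).hasMap_X.2).map _

/-- **`Λ₂ : D₂ → E₁`** — the extension of `Λ₁` to the roof. [folklore] -/
def Λ₂ : D₂ C ε H hBw →+* C.E₁ ε H :=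
  IsLocalization.Away.lift (gEW C ε H hBw) (g := Λ₁ C ε H) (isUnit_Λ₁_gEW C ε H hBw hjW)

/-- `Λ₂` extends `Λ₁`. [folklore] -/
@[simp] theorem Λ₂_algebraMap (x : D₁ C e H.hj H.hje) :
    Λ₂ C ε H hBw hjW (algebraMap (D₁ C e H.hj H.hje) (D₂ C ε H hBw) x) = Λ₁ C ε H x :=
  IsLocalization.Away.lift_eq _ _ x

/-- `Λ₂` extends `Λ₀`. [folklore] -/
@[simp] theorem Λ₂_algebraMap_D₀ (x : C.D₀ e H.hj H.hje) :
    Λ₂ C ε H hBw hjW (algebraMap (C.D₀ e H.hj H.hje) (D₂ C ε H hBw) x) = C.Λ₀ ε H x := by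
  rw [IsScalarTower.algebraMap_apply (C.D₀ e H.hj H.hje) (D₁ C e H.hj H.hje) (D₂ C ε H hBw),
    Λ₂_algebraMap, Λ₁_algebraMap]

/-- `Λ₂ ∘ μB₂ = m°[X] → E₁`. [folklore] -/
theorem Λ₂_μB₂ (q : MvPolynomial (Fin C.n) O) :
    Λ₂ C ε H hBw hjW (μB₂ C ε H hBw q) = algebraMap (MvPolynomial (Fin C.n) O) (C.E₁ ε H) q := by
  rw [μB₂, RingHom.comp_apply, Λ₂_algebraMap, ← RingHom.comp_apply, Λ₁_comp_μB]

/-- `Λ₂ ∘ μ` as an `m°[X]`-algebra map. [folklore] -/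
def Λ₂μ : C.E₀ ε →ₐ[MvPolynomial (Fin C.n) O] C.E₁ ε H :=
  { toRingHom := (Λ₂ C ε H hBw hjW).comp (μ C ε H hBw hjW : C.E₀ ε →+* D₂ C ε H hBw)
    commutes' := fun q => by
      change Λ₂ C ε H hBw hjW (μ C ε H hBw hjW (algebraMap _ _ q)) = _
      rw [μ_algebraMap, Λ₂_μB₂] }

/-- **(β) `Λ₂ ∘ μ = E₀ → E₁`.** [folklore] -/
theorem Λ₂μ_eq : Λ₂μ C ε H hBw hjW = IsScalarTower.toAlgHom (MvPolynomial (Fin C.n) O) (C.E₀ ε) (C.E₁ ε H) := by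
  refine EtalePair.hom_ext ?_
  change Λ₂ C ε H hBw hjW (μ C ε H hBw hjW (C.W ε)) = algebraMap (C.E₀ ε) (C.E₁ ε H) (C.W ε)
  rw [μ_W, WD₂, Λ₂_algebraMap, Λ₁_WD₁ C ε H hBw hjW]

/-- `Λ₂(μ x) = x`. [folklore] -/
@[simp] theorem Λ₂_μ (x : C.E₀ ε) : Λ₂ C ε H hBw hjW (μ C ε H hBw hjW x) = algebraMap (C.E₀ ε) (C.E₁ ε H) x := by
  have := congrArg (fun f => f x) (Λ₂μ_eq C ε H hBw hjW)
  simpa [Λ₂μ] using this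

/-- `Λ₂ ∘ μ₁ = id`. [folklore] -/
theorem Λ₂_comp_μ₁ : (Λ₂ C ε H hBw hjW).comp (μ₁ C ε H hBw hjW) = RingHom.id (C.E₁ ε H) := by
  refine IsLocalization.ringHom_ext (Submonoid.powers (C.gDlam ε H)) ?_
  ext x
  simp only [RingHom.coe_comp, Function.comp_apply, μ₁_algebraMap, Λ₂_μ, RingHom.id_apply]

/-- `μ₁ ∘ Λ₁ = D₁ → D₂`. [folklore] -/
theorem μ₁_comp_Λ₁ : (μ₁ C ε H hBw hjW).comp (Λ₁ C ε H) = algebraMap (D₁ C e H.hj H.hje) (D₂ C ε H hBw) := by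
  refine IsLocalization.ringHom_ext (Submonoid.powers (θf C e H.hj H.hje)) ?_
  ext x
  simp only [RingHom.coe_comp, Function.comp_apply, Λ₁_algebraMap, μ₁_Λ₀]
  exact (IsScalarTower.algebraMap_apply _ _ _ x).symm

/-- `μ₁ ∘ Λ₂ = id`. [folklore] -/
theorem μ₁_comp_Λ₂ : (μ₁ C ε H hBw hjW).comp (Λ₂ C ε H hBw hjW) = RingHom.id (D₂ C ε H hBw) := by
  refine IsLocalization.ringHom_ext (Submonoid.powers (gEW C ε H hBw)) ?_
  ext x
  simp only [RingHom.coe_comp, Function.comp_apply, Λ₂_algebraMap, RingHom.id_apply]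
  exact congrArg (fun f => f x) (μ₁_comp_Λ₁ C ε H hBw hjW)

/-- **The isomorphism of the two charts: `E₁ ≃ D₂`.** [folklore] -/
def roofEquiv : C.E₁ ε H ≃+* D₂ C ε H hBw :=
  RingEquiv.ofRingHom (μ₁ C ε H hBw hjW) (Λ₂ C ε H hBw hjW) (μ₁_comp_Λ₂ C ε H hBw hjW) (Λ₂_comp_μ₁ C ε H hBw hjW)

/-- `roofEquiv = μ₁` as functions. [folklore] -/
@[simp] theorem roofEquiv_apply (x : C.E₁ ε H) : roofEquiv C ε H hBw hjW x = μ₁ C ε H hBw hjW x := rfl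

end StepXV

/-! ## XVI. The common smooth roof -/

section StepXVI

section RoofSmooth

variable (ε : C.EParams) {e j : ℕ} (H : C.EHyps ε e j) (hBw : C.Bw ≤ j)
  (hjW : C.Bw + (C.N₀ + ε.r + C.dΘ) ≤ j)

/-! ### The roof over the refined model `A′_j` -/

/-- `A′_j ≤ A″_j`. [folklore] -/
theorem Aj_le_A'' : C.Aj j ≤ C.A'' H.hj := (C.Aj_le_A''₀ H.hj₀).trans (C.A''₀_le_A'' H.hj)

/-- The roof as an `A′_j`-algebra (through `A′_j ⊆ A″_j → D₂`). [folklore] -/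
abbrev algAjD₂ : Algebra (C.Aj j) (D₂ C ε H hBw) :=
  ((algebraMap (C.A'' H.hj) (D₂ C ε H hBw)).comp (Subring.inclusion (Aj_le_A'' C ε H))).toAlgebra

/-- **`A″_j` is smooth over `A′_j`** (two localizations away from elements). [folklore] -/
theorem smooth_Aj_A'' :
    letI : Algebra (C.Aj j) (C.A'' H.hj) := (Subring.inclusion (Aj_le_A'' C ε H)).toAlgebra
    Algebra.Smooth (C.Aj j) (C.A'' H.hj) := by
  letI algA : Algebra (C.Aj j) (C.A''₀ H.hj₀) := algebra_awaySubring (C.Aj j) C.d (C.d_mem_Aj H.hj₀)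
  haveI : IsLocalization.Away (C.dAj ε H) (C.A''₀ H.hj₀) :=
    isLocalization_awaySubring (C.Aj j) (C.d_mem_Aj H.hj₀) C.d_ne_zero
  letI algB : Algebra (C.A''₀ H.hj₀) (C.A'' H.hj) :=
    algebra_awaySubring (C.A''₀ H.hj₀) (C.t H.hj) (C.t_mem_A''₀ H.hj)
  haveI : IsLocalization.Away (C.tA₀ ε H) (C.A'' H.hj) :=
    isLocalization_awaySubring (C.A''₀ H.hj₀) (C.t_mem_A''₀ H.hj) (C.t_ne_zero H.hj)
  letI : Algebra (C.Aj j) (C.A'' H.hj) := (Subring.inclusion (Aj_le_A'' C ε H)).toAlgebra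
  haveI : IsScalarTower (C.Aj j) (C.A''₀ H.hj₀) (C.A'' H.hj) := IsScalarTower.of_algebraMap_eq fun _ => rfl
  haveI : Algebra.Smooth (C.Aj j) (C.A''₀ H.hj₀) := Algebra.Smooth.of_isLocalization_Away (C.dAj ε H)
  haveI : Algebra.Smooth (C.A''₀ H.hj₀) (C.A'' H.hj) := Algebra.Smooth.of_isLocalization_Away (C.tA₀ ε H)
  exact Algebra.Smooth.comp (C.Aj j) (C.A''₀ H.hj₀) (C.A'' H.hj)

/-- **The roof is smooth over `A′_j`.** [folklore] -/
theorem smooth_Aj_D₂ : letI := algAjD₂ C ε H hBw; Algebra.Smooth (C.Aj j) (D₂ C ε H hBw) := by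
  letI : Algebra (C.Aj j) (C.A'' H.hj) := (Subring.inclusion (Aj_le_A'' C ε H)).toAlgebra
  letI := algAjD₂ C ε H hBw
  haveI : IsScalarTower (C.Aj j) (C.A'' H.hj) (D₂ C ε H hBw) :=
    IsScalarTower.of_algebraMap_eq (R := C.Aj j) (S := C.A'' H.hj) (A := D₂ C ε H hBw) fun _ => rfl
  haveI := smooth_Aj_A'' C ε H
  exact Algebra.Smooth.comp (C.Aj j) (C.A'' H.hj) (D₂ C ε H hBw)

/-! ### The roof over `m°` -/

/-- The roof as an `m°`-algebra (through `μO : m° → D₁ → D₂`). [folklore] -/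
abbrev algOD₂ : Algebra O (D₂ C ε H hBw) := (μO₂ C ε H hBw).toAlgebra

/-- The isomorphism `E₁ ≃ D₂` is an `m°`-algebra isomorphism. [folklore] -/
def roofAlgEquiv : letI := algOD₂ C ε H hBw; C.E₁ ε H ≃ₐ[O] D₂ C ε H hBw :=
  letI := algOD₂ C ε H hBw
  AlgEquiv.ofRingEquiv (f := roofEquiv C ε H hBw hjW) fun a => by
    rw [roofEquiv_apply, IsScalarTower.algebraMap_apply O (C.E₀ ε) (C.E₁ ε H), μ₁_algebraMap,
      μ_algebraMap_O]
    rfl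

include hjW in
/-- **The roof is smooth over `m°`.** [folklore] -/
theorem smooth_O_D₂ : letI := algOD₂ C ε H hBw; Algebra.Smooth O (D₂ C ε H hBw) := by
  letI := algOD₂ C ε H hBw
  exact Algebra.Smooth.of_equiv (roofAlgEquiv C ε H hBw hjW)

/-! ### The point of the roof and the smooth-equivalence -/

/-- The point `r₂ ⊂ D₂` over the centre of `m°`. [folklore] -/
def r₂ : Ideal (D₂ C ε H hBw) := (IsLocalRing.maximalIdeal O).comap (σ₂ C ε H hBw)

/-- `r₂` is prime. [folklore] -/
instance r₂_isPrime : (r₂ C ε H hBw).IsPrime := by unfold r₂; exact Ideal.comap_isPrime _ _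

include H hBw hjW in
/-- **The centre of `m°` on `X′ = Spec A′_j` is smooth-equivalent over `k°` to the closed point
of `Spec m°`** (Temkin 2013, Definition 2.8.1; the roof `D₂` with its point `r₂`). [folklore] -/
theorem areSmoothEquivalent_centre (hA' : ∀ a ∈ C.Aj j, a ∈ Algebra.adjoin k (A : Set K))
    (hi' : ∀ a : C.Aj j, φ ⟨a, hA' a a.2⟩ ∈ O) (hkA' : ∀ c : V, algebraMap k K c ∈ C.Aj j)
    (hkm : ∀ c : V, algebraMap k m c ∈ O) :
    AreSmoothEquivalent
      (((algebraMap k K).comp V.subtype).codRestrict (C.Aj j) hkA')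
      (((algebraMap k m).comp V.subtype).codRestrict O hkm)
      ((IsLocalRing.maximalIdeal O).comap
        (liftToValuationSubring (Algebra.adjoin k (A : Set K)) φ (C.Aj j) hA' O hi'))
      (IsLocalRing.maximalIdeal O) := by
  letI := algAjD₂ C ε H hBw
  letI := algOD₂ C ε H hBw
  refine ⟨D₂ C ε H hBw, inferInstance, algAjD₂ C ε H hBw, algOD₂ C ε H hBw, ?_,
    smooth_Aj_D₂ C ε H hBw, smooth_O_D₂ C ε H hBw hjW, r₂ C ε H hBw, inferInstance, ?_, ?_⟩
  · -- the two `k°`-structures agree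
    ext c
    change algebraMap (C.A'' H.hj) (D₂ C ε H hBw) (Subring.inclusion (Aj_le_A'' C ε H) ⟨algebraMap k K c, hkA' c⟩) =
      μO₂ C ε H hBw ⟨algebraMap k m c, hkm c⟩
    rw [show (Subring.inclusion (Aj_le_A'' C ε H) ⟨algebraMap k K c, hkA' c⟩ : C.A'' H.hj) =
      C.baseToA'' H.hj c from Subtype.ext rfl, show (⟨algebraMap k m c, hkm c⟩ : O) = C.vO c from Subtype.ext rfl,
      μO₂, RingHom.comp_apply, μO_vO, ← IsScalarTower.algebraMap_apply]
  · -- the point over the centre of `m°` on `A′_j`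
    ext a
    rw [Ideal.mem_comap, r₂, Ideal.mem_comap, Ideal.mem_comap]
    have hval : (σ₂ C ε H hBw (algebraMap (C.Aj j) (D₂ C ε H hBw) a) : O) =
        liftToValuationSubring (Algebra.adjoin k (A : Set K)) φ (C.Aj j) hA' O hi' a := by
      apply Subtype.ext
      change (σ₂ C ε H hBw (algebraMap (C.A'' H.hj) (D₂ C ε H hBw) (Subring.inclusion (Aj_le_A'' C ε H) a)) : m) = _
      rw [σ₂_algebraMap_A'', liftToValuationSubring_apply]
      exact ev_eq_φ φ (hA' a a.2)
    rw [hval]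
  · -- the point over the closed point of `Spec m°`
    ext a
    rw [Ideal.mem_comap, r₂, Ideal.mem_comap]
    change σ₂ C ε H hBw (μO₂ C ε H hBw a) ∈ _ ↔ _
    rw [σ₂_μO₂]

end RoofSmooth

/-! ### Existence of admissible parameters -/

section Params


/-- The `b`-exponent bound of the generators `f`. [folklore] -/
def rf : ℕ := C.f.attach.sup fun z => C.repb ⟨z.1, C.A₀_subset_Rh (C.f_subset_A₀ z.2)⟩

/-- `b_z ≤ rf` for `z ∈ f`. [folklore] -/
theorem repb_le_rf {z : K} (hz : z ∈ C.f) : C.repb ⟨z, C.A₀_subset_Rh (C.f_subset_A₀ hz)⟩ ≤ rf C := by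
  have h := Finset.le_sup (s := C.f.attach)
    (f := fun z : {z // z ∈ C.f} => C.repb ⟨z.1, C.A₀_subset_Rh (C.f_subset_A₀ z.2)⟩)
    (Finset.mem_attach C.f ⟨z, hz⟩)
  exact h

/-- The Newton zoom: dominates all the `b`-exponents and `N_g`. [folklore] -/
def r₀ : ℕ := C.Ng + C.repb C.sR + C.repb C.hR + C.repb C.tR + C.repb C.yR + C.repb C.ayR + C.repb C.raR + rf C

/-- The polydisc zoom. [folklore] -/
def jz₀ : ℕ := r₀ C + 2 * C.N₀ + C.Na + C.jH + C.bp + 2 * C.Na + C.Bw + C.N₀ + r₀ C + C.dΘ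

/-- The built-in units `s, h, t`. [folklore] -/
def U₀ : List C.Rh := [C.sR, C.hR, C.tR]

/-- Values of the built-in units lie in `m°`. [folklore] -/
theorem U₀_mem_O : ∀ z ∈ U₀ C, C.φh z ∈ O := by
  intro z hz
  simp only [U₀, List.mem_cons, List.not_mem_nil, or_false] at hz
  rcases hz with rfl | rfl | rfl
  · rw [C.φh_sR]; exact O.one_mem
  · rw [C.φh_hR]; exact O.one_mem
  · exact C.φh_tR_mem

/-- Values of the built-in units are units of `m°`. [folklore] -/
theorem U₀_isUnit : ∀ z (hz : z ∈ U₀ C), IsUnit (⟨C.φh z, U₀_mem_O C z hz⟩ : O) := by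
  intro z hz
  have hz' := hz
  simp only [U₀, List.mem_cons, List.not_mem_nil, or_false] at hz'
  rcases hz' with rfl | rfl | rfl
  · rw [show (⟨C.φh C.sR, U₀_mem_O C _ hz⟩ : O) = 1 from Subtype.ext C.φh_sR]; exact isUnit_one
  · rw [show (⟨C.φh C.hR, U₀_mem_O C _ hz⟩ : O) = 1 from Subtype.ext C.φh_hR]; exact isUnit_one
  · exact C.isUnit_φh_tR

/-- `b_z ≤ r₀` for the built-in units. [folklore] -/
theorem U₀_repb_le : ∀ z ∈ U₀ C, C.repb z ≤ r₀ C := by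
  intro z hz
  simp only [U₀, List.mem_cons, List.not_mem_nil, or_false] at hz
  rcases hz with rfl | rfl | rfl <;> unfold r₀ <;> omega

/-- **The parameters of the polydisc chart.** [folklore] -/
def ε₀ : C.EParams where
  r := r₀ C
  jz := jz₀ C
  U := U₀ C
  hUO := U₀_mem_O C
  hUunit := U₀_isUnit C
  hUr := U₀_repb_le C
  hNg := by unfold r₀; omega
  hjz := by unfold jz₀; omega

/-- The zoom level `j = j_z + c`. [folklore] -/
def j₀ε : ℕ := jz₀ C + C.c

/-- **The hypotheses tying the two charts hold** for `(ε₀, e = 0, j = j_z + c)`. [folklore] -/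
theorem eHyps₀ : C.EHyps (ε₀ C) 0 (j₀ε C) where
  hj := by unfold j₀ε jz₀; omega
  hje := by unfold j₀ε jz₀; omega
  hjc := rfl
  hsU := by change C.sR ∈ U₀ C; simp [U₀]
  hhU := by change C.hR ∈ U₀ C; simp [U₀]
  htU := by change C.tR ∈ U₀ C; simp [U₀]
  hfr := fun z hz => le_trans (repb_le_rf C hz) (by change rf C ≤ r₀ C; unfold r₀; omega)
  hyr := by change C.repb C.yR ≤ r₀ C; unfold r₀; omega
  hayr := by change C.repb C.ayR ≤ r₀ C; unfold r₀; omega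
  hrar := by change C.repb C.raR ≤ r₀ C; unfold r₀; omega
  hM := by change 0 + C.Na ≤ jz₀ C - r₀ C - 2 * C.N₀; unfold jz₀; omega

/-- `Bw ≤ j`. [folklore] -/
theorem Bw_le_j₀ε : C.Bw ≤ j₀ε C := by unfold j₀ε jz₀; omega

/-- `Bw + (N₀ + r + dΘ) ≤ j`. [folklore] -/
theorem Bw_add_le_j₀ε : C.Bw + (C.N₀ + (ε₀ C).r + C.dΘ) ≤ j₀ε C := by
  change C.Bw + (C.N₀ + r₀ C + C.dΘ) ≤ jz₀ C + C.c; unfold jz₀; omega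

include C in
/-- **The conclusion of Lemma 3.3.2 for a chart**: the refinement `A′ = A′_j` of the model and the
smooth-equivalence of the centre of `m°` on it with the closed point of `Spec m°`, in the exact
form of `Temkin2013_Lemma332_nft`. [folklore] -/
theorem conclusion :
    ∃ (A' : Subring K), A ≤ A' ∧ IsAffineNormalizedModel ⊤ (baseRing K V) A' ∧
      ∃ (hA' : ∀ a ∈ A', a ∈ Algebra.adjoin k (A : Set K))
        (hi' : ∀ a : A', φ ⟨a, hA' a a.2⟩ ∈ O)
        (hkA' : ∀ c : V, algebraMap k K c ∈ A') (hkm : ∀ c : V, algebraMap k m c ∈ O),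
        AreSmoothEquivalent
          (((algebraMap k K).comp V.subtype).codRestrict A' hkA')
          (((algebraMap k m).comp V.subtype).codRestrict O hkm)
          ((IsLocalRing.maximalIdeal O).comap
            (liftToValuationSubring (Algebra.adjoin k (A : Set K)) φ A' hA' O hi'))
          (IsLocalRing.maximalIdeal O) := by
  have hA' : ∀ a ∈ C.Aj (j₀ε C), a ∈ Algebra.adjoin k (A : Set K) := fun a ha => C.Aj_le_R _ ha
  have hi' : ∀ a : C.Aj (j₀ε C), φ ⟨a, hA' a a.2⟩ ∈ O := fun a => by
    rw [← ev_eq_φ φ (hA' a a.2)]; exact C.ev_mem_O_of_mem_Aj _ a.2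
  have hkA' : ∀ c : V, algebraMap k K c ∈ C.Aj (j₀ε C) := fun c =>
    C.A_le_Aj _ (C.A₀_le_A (C.algebraMap_mem_A₀ c.2))
  have hkm : ∀ c : V, algebraMap k m c ∈ O := fun c => C.algebraMap_mem_O c.2
  exact ⟨C.Aj (j₀ε C), C.A_le_Aj _, C.isAffineNormalizedModel_Aj _, hA', hi', hkA', hkm,
    areSmoothEquivalent_centre C (ε₀ C) (eHyps₀ C) (Bw_le_j₀ε C) (Bw_add_le_j₀ε C) hA' hi' hkA' hkm⟩

end Params

end StepXVI

end Roof

end DecompChart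

/-! ## The discharge of `Temkin2013_Lemma332_nft` -/

/-- **Temkin's decompletion lemma (Temkin 2013, Lemma 3.3.2, corrected rendering
`Temkin2013_Lemma332_nft`) — PROVED**, by the algebraic proof of the series `Decompletion*.lean`:
for the data of the lemma, `exists_decompChart` (`DecompletionSetup.lean`) provides the étale
chart of the generic fibre at the simple smooth point adapted to the valuation,
`DecompChart.Roof.conclusion` the refinement `X′ = Spec A′_j` (`A′_j = Nr_K(k°[f, τ/πʲ])`,
Temkin's `Nr(Spec A[f/π])`), the lifting `i′` of `i`, and the common smooth roof `D₂` of
`(X′, centre of m°)` and `(Spec m°, closed point)` over `k°`. (The equal-characteristic hypothesis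
of the fact is not used.) [cite: Temkin2013, Lemma 3.3.2 (arXiv:0804.1554v3 pp. 45–46)] -/
theorem Temkin2013_Lemma332_nft_holds : Temkin2013_Lemma332_nft.{u} := by
  intro k K _ _ _ Ok _ hdim A hA hFG m _ _ φ hφ x _ hker hsm hsep Om hOm hi
  obtain ⟨C⟩ := exists_decompChart Ok hdim A hA hFG φ hφ x hker hsm Om hOm hi
  exact DecompChart.Roof.conclusion C

end Literature.AlgebraicGeometry.Resolution
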